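import Literature.NumberTheory.Transcendental.KZCubeTransverse
import HarnessLib

/-!
# The cube calculus of end-regularised iterated integrals, III: joints, the diagonal (S), axis
commutation

Tools for identities between PRODUCTS of two regularised transports read at a common scale:

* JOINT word functions `boxT T₁ T₂` (two word blocks sharing riders and scale), the absorbed
  multiplier `absorbR` and the absorb/swap identities, joint functionals at residues `JZ, JD, JY`
  (slot 1 active) and `JZ', JD'` (slot 2 active), the honest double functional `HH` and the slot
  change `JZ_eq_JZ'`;
* the DIAGONAL rider Stokes move (`chi_famTerm_famY_diag`): transverse rider and scale tied to the
  same rider polynomial; substitution of the transverse rider in direction data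
  (`DirData.substY`) with the bridges `fn_famY_Zw_substY`, `fn_famY_YZw`, and the diagonal (S) for
  singles (`ZS_substY_diag_S`) and joints (`JZ_substY_diag_S`);
* AXIS COMMUTATION (`DirData.comm_ZS_of_axisComm`): a residue commuting with the axis residue and
  with the connection pointwise commutes with every regularised series (the edge centralities
  `[Z₀, Ω_y(0,y)] = 0` of a corner chart [Furusho2010, §3]);
* the transport equation at residues for any number of riders (`DS_succ'`, dummy riders) and the
  expansions of the joint functionals in the active slot (`JD_succ`, `JY_tfz`, `JD'_succ`).

References: [cite: IharaKanekoZagier2006, §3]; [cite: KontsevichZagier2001, §1.2];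
H. Furusho, Ann. of Math. 171 (2010), §3.
-/

noncomputable section

open MeasureTheory Set MvPolynomial
open Literature.ModelTheory.ExponentialFields (IsSemialgebraic analyticOnNhd_aeval continuous_aeval_real)
open Literature.NumberTheory.Transcendental

namespace Literature.NumberTheory.Transcendental.KZ.Cube

variable {M N : ℕ}

/-! ## Joint word functions: two word blocks sharing riders and scale -/

section Joint

variable {R : Type} [CommRing R] {χ : KZ.FormalRep →+ R} (hrel : ∀ c ∈ KZ.relations, χ c = 0)
variable {m n₁ n₂ k : ℕ}

/-- The substitution reading the first word block. [folklore] -/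
def subB₁ (n₁ n₂ m : ℕ) : Fin ((n₁ + m) + 1) → MvPolynomial (Fin (((n₁ + n₂) + m) + 1)) ℚ :=
  Fin.lastCases (X (Fin.last _))
    (Fin.addCases (fun j : Fin n₁ => X (Fin.castSucc (Fin.castAdd m (Fin.castAdd n₂ j))))
      (fun j : Fin m => X (Fin.castSucc (Fin.natAdd (n₁ + n₂) j))))

/-- The substitution reading the second word block. [folklore] -/
def subB₂ (n₁ n₂ m : ℕ) : Fin ((n₂ + m) + 1) → MvPolynomial (Fin (((n₁ + n₂) + m) + 1)) ℚ :=
  Fin.lastCases (X (Fin.last _))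
    (Fin.addCases (fun j : Fin n₂ => X (Fin.castSucc (Fin.castAdd m (Fin.natAdd n₁ j))))
      (fun j : Fin m => X (Fin.castSucc (Fin.natAdd (n₁ + n₂) j))))

/-- The point of the first block. [folklore] -/
def projB₁ (z : Fin (((n₁ + n₂) + m) + 1) → ℝ) : Fin ((n₁ + m) + 1) → ℝ :=
  Fin.snoc (Fin.append (fun j : Fin n₁ => wX z (Fin.castAdd n₂ j)) (wRider z)) (wScale z)

/-- The point of the second block. [folklore] -/
def projB₂ (z : Fin (((n₁ + n₂) + m) + 1) → ℝ) : Fin ((n₂ + m) + 1) → ℝ :=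
  Fin.snoc (Fin.append (fun j : Fin n₂ => wX z (Fin.natAdd n₁ j)) (wRider z)) (wScale z)

/-- Evaluating the first block substitution. [folklore] -/
theorem aeval_subB₁ (z : Fin (((n₁ + n₂) + m) + 1) → ℝ) : (fun i => aeval z (subB₁ n₁ n₂ m i)) = projB₁ z := by
  funext i
  induction i using Fin.lastCases with
  | last => simp [subB₁, projB₁, wScale]
  | cast i =>
    simp only [subB₁, projB₁, Fin.lastCases_castSucc, Fin.snoc_castSucc]
    induction i using Fin.addCases with
    | left j => simp [wX]
    | right j => simp [wRider]

/-- Evaluating the second block substitution. [folklore] -/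
theorem aeval_subB₂ (z : Fin (((n₁ + n₂) + m) + 1) → ℝ) : (fun i => aeval z (subB₂ n₁ n₂ m i)) = projB₂ z := by
  funext i
  induction i using Fin.lastCases with
  | last => simp [subB₂, projB₂, wScale]
  | cast i =>
    simp only [subB₂, projB₂, Fin.lastCases_castSucc, Fin.snoc_castSucc]
    induction i using Fin.addCases with
    | left j => simp [wX]
    | right j => simp [wRider]

/-- Word coordinates of the first block point. [folklore] -/
@[simp] theorem wX_projB₁ (z : Fin (((n₁ + n₂) + m) + 1) → ℝ) (j : Fin n₁) : wX (projB₁ z) j = wX z (Fin.castAdd n₂ j) := by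
  show (Fin.snoc _ _ : Fin ((n₁ + m) + 1) → ℝ) (Fin.castSucc (Fin.castAdd m j)) = _
  rw [Fin.snoc_castSucc, Fin.append_left]

/-- Riders of the first block point. [folklore] -/
@[simp] theorem wRider_projB₁ (z : Fin (((n₁ + n₂) + m) + 1) → ℝ) : wRider (projB₁ z) = wRider z := by
  funext j
  show (Fin.snoc _ _ : Fin ((n₁ + m) + 1) → ℝ) (Fin.castSucc (Fin.natAdd n₁ j)) = _
  rw [Fin.snoc_castSucc, Fin.append_right]

/-- Scale of the first block point. [folklore] -/
@[simp] theorem wScale_projB₁ (z : Fin (((n₁ + n₂) + m) + 1) → ℝ) : wScale (projB₁ z) = wScale z := by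
  show (Fin.snoc _ _ : Fin ((n₁ + m) + 1) → ℝ) (Fin.last _) = _
  rw [Fin.snoc_last]

/-- Word coordinates of the second block point. [folklore] -/
@[simp] theorem wX_projB₂ (z : Fin (((n₁ + n₂) + m) + 1) → ℝ) (j : Fin n₂) : wX (projB₂ z) j = wX z (Fin.natAdd n₁ j) := by
  show (Fin.snoc _ _ : Fin ((n₂ + m) + 1) → ℝ) (Fin.castSucc (Fin.castAdd m j)) = _
  rw [Fin.snoc_castSucc, Fin.append_left]

/-- Riders of the second block point. [folklore] -/
@[simp] theorem wRider_projB₂ (z : Fin (((n₁ + n₂) + m) + 1) → ℝ) : wRider (projB₂ z) = wRider z := by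
  funext j
  show (Fin.snoc _ _ : Fin ((n₂ + m) + 1) → ℝ) (Fin.castSucc (Fin.natAdd n₂ j)) = _
  rw [Fin.snoc_castSucc, Fin.append_right]

/-- Scale of the second block point. [folklore] -/
@[simp] theorem wScale_projB₂ (z : Fin (((n₁ + n₂) + m) + 1) → ℝ) : wScale (projB₂ z) = wScale z := by
  show (Fin.snoc _ _ : Fin ((n₂ + m) + 1) → ℝ) (Fin.last _) = _
  rw [Fin.snoc_last]

/-- The block points of a cube point lie in the cube. [folklore] -/
theorem projB_mem {z : Fin (((n₁ + n₂) + m) + 1) → ℝ} (hz : z ∈ KZ.cube (((n₁ + n₂) + m) + 1)) :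
    projB₁ z ∈ KZ.cube ((n₁ + m) + 1) ∧ projB₂ z ∈ KZ.cube ((n₂ + m) + 1) := by
  constructor
  · intro i
    induction i using Fin.lastCases with
    | last => simp only [projB₁, Fin.snoc_last]; exact hz _
    | cast i =>
      simp only [projB₁, Fin.snoc_castSucc]
      induction i using Fin.addCases with
      | left j => simp only [Fin.append_left]; exact hz _
      | right j => simp only [Fin.append_right]; exact hz _
  · intro i
    induction i using Fin.lastCases with
    | last => simp only [projB₂, Fin.snoc_last]; exact hz _
    | cast i =>
      simp only [projB₂, Fin.snoc_castSucc]
      induction i using Fin.addCases with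
      | left j => simp only [Fin.append_left]; exact hz _
      | right j => simp only [Fin.append_right]; exact hz _

/-- **The joint word function** `(T₁ ⊠ T₂)(x₁, x₂; e; τ) = T₁(x₁; e; τ) T₂(x₂; e; τ)`: two word blocks
sharing the riders and the scale — the cube form of the transport along a broken path (Chen's
product). [cite: KontsevichZagier2001, §4.1] -/
def boxT (T₁ : RFun ((n₁ + m) + 1)) (T₂ : RFun ((n₂ + m) + 1)) : RFun (((n₁ + n₂) + m) + 1) :=
  (T₁.subst (subB₁ n₁ n₂ m) fun z hz => by rw [aeval_subB₁]; exact (projB_mem hz).1).mul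
    (T₂.subst (subB₂ n₁ n₂ m) fun z hz => by rw [aeval_subB₂]; exact (projB_mem hz).2)

/-- Value of the joint word function. [folklore] -/
theorem fn_boxT (T₁ : RFun ((n₁ + m) + 1)) (T₂ : RFun ((n₂ + m) + 1)) (z : Fin (((n₁ + n₂) + m) + 1) → ℝ) :
    (boxT T₁ T₂).fn z = T₁.fn (projB₁ z) * T₂.fn (projB₂ z) := by
  rw [boxT, RFun.fn_mul, RFun.fn_subst, RFun.fn_subst, aeval_subB₁, aeval_subB₂]

/-- The block points of a `snoc` point, as `snoc` points of scale-free initial segments. [folklore] -/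
theorem projB_snoc_eq (p : Fin ((n₁ + n₂) + m) → ℝ) (t : ℝ) :
    projB₁ (Fin.snoc p t : Fin (((n₁ + n₂) + m) + 1) → ℝ) =
      Fin.snoc (Fin.append (fun j : Fin n₁ => p (Fin.castAdd m (Fin.castAdd n₂ j))) (fun j : Fin m => p (Fin.natAdd (n₁ + n₂) j))) t ∧
    projB₂ (Fin.snoc p t : Fin (((n₁ + n₂) + m) + 1) → ℝ) =
      Fin.snoc (Fin.append (fun j : Fin n₂ => p (Fin.castAdd m (Fin.natAdd n₁ j))) (fun j : Fin m => p (Fin.natAdd (n₁ + n₂) j))) t := by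
  constructor
  · apply layout_ext
    · funext j; rw [wX_projB₁, wX_snoc, wX_snoc]; simp only [Fin.append_left]
    · rw [wRider_projB₁, wRider_snoc, wRider_snoc]; funext j; simp only [Fin.append_right]
    · rw [wScale_projB₁, wScale_snoc, wScale_snoc]
  · apply layout_ext
    · funext j; rw [wX_projB₂, wX_snoc, wX_snoc]; simp only [Fin.append_left]
    · rw [wRider_projB₂, wRider_snoc, wRider_snoc]; funext j; simp only [Fin.append_right]
    · rw [wScale_projB₂, wScale_snoc, wScale_snoc]

/-- **Product rule for the scale derivative of a `τ`-weighted joint function**: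
`∂_τ(τ · τ T₁T₂) = τ (∂_τ(τT₁) T₂ + T₁ ∂_τ(τT₂))` at cube points. [folklore] -/
theorem fn_scaleDeriv_X_boxT (T₁ : RFun ((n₁ + m) + 1)) (T₂ : RFun ((n₂ + m) + 1)) {p : Fin ((n₁ + n₂) + m) → ℝ}
    (hp : p ∈ KZ.cube ((n₁ + n₂) + m)) {t₀ : ℝ} (ht₀ : t₀ ∈ Icc (0 : ℝ) 1) :
    (scaleDeriv ((RFun.poly (X (Fin.last ((n₁ + n₂) + m)))).mul (boxT T₁ T₂))).fn (Fin.snoc p t₀) =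
      t₀ * ((boxT (scaleDeriv T₁) T₂).fn (Fin.snoc p t₀) + (boxT T₁ (scaleDeriv T₂)).fn (Fin.snoc p t₀)) := by
  set F : RFun (((n₁ + n₂) + m) + 1) := (RFun.poly (X (Fin.last ((n₁ + n₂) + m)))).mul (boxT T₁ T₂) with hF
  set q₁ : Fin (n₁ + m) → ℝ := Fin.append (fun j : Fin n₁ => p (Fin.castAdd m (Fin.castAdd n₂ j)))
    (fun j : Fin m => p (Fin.natAdd (n₁ + n₂) j)) with hq₁
  set q₂ : Fin (n₂ + m) → ℝ := Fin.append (fun j : Fin n₂ => p (Fin.castAdd m (Fin.natAdd n₁ j)))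
    (fun j : Fin m => p (Fin.natAdd (n₁ + n₂) j)) with hq₂
  have hq₁m : q₁ ∈ KZ.cube (n₁ + m) := by
    intro i; induction i using Fin.addCases with
    | left j => simp only [hq₁, Fin.append_left]; exact hp _
    | right j => simp only [hq₁, Fin.append_right]; exact hp _
  have hq₂m : q₂ ∈ KZ.cube (n₂ + m) := by
    intro i; induction i using Fin.addCases with
    | left j => simp only [hq₂, Fin.append_left]; exact hp _
    | right j => simp only [hq₂, Fin.append_right]; exact hp _
  have hpr : ∀ t : ℝ, projB₁ (Fin.snoc p t : Fin (((n₁ + n₂) + m) + 1) → ℝ) = Fin.snoc q₁ t ∧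
      projB₂ (Fin.snoc p t : Fin (((n₁ + n₂) + m) + 1) → ℝ) = Fin.snoc q₂ t := fun t => projB_snoc_eq p t
  -- the function along the fibre and its derivative
  have hFval : ∀ t, F.fn (Fin.snoc p t) = t * (T₁.fn (Fin.snoc q₁ t) * T₂.fn (Fin.snoc q₂ t)) := by
    intro t; rw [hF, RFun.fn_mul, RFun.fn_poly, aeval_X, Fin.snoc_last, fn_boxT, (hpr t).1, (hpr t).2]
  have h1 : HasDerivAt (fun t => F.fn (Fin.snoc p t)) (F.dlast.fn (Fin.snoc p t₀)) t₀ := F.hasDerivAt_fn_snoc hp ht₀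
  rw [funext hFval] at h1
  have h2 : HasDerivAt (fun t : ℝ => t * (T₁.fn (Fin.snoc q₁ t) * T₂.fn (Fin.snoc q₂ t)))
      (1 * (T₁.fn (Fin.snoc q₁ t₀) * T₂.fn (Fin.snoc q₂ t₀)) + t₀ * (T₁.dlast.fn (Fin.snoc q₁ t₀) * T₂.fn (Fin.snoc q₂ t₀) +
        T₁.fn (Fin.snoc q₁ t₀) * T₂.dlast.fn (Fin.snoc q₂ t₀))) t₀ :=
    (hasDerivAt_id t₀).mul ((T₁.hasDerivAt_fn_snoc hq₁m ht₀).mul (T₂.hasDerivAt_fn_snoc hq₂m ht₀))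
  have hd := h1.unique h2
  rw [fn_scaleDeriv _ hp ht₀, hd, hFval, fn_boxT, fn_boxT, (hpr t₀).1, (hpr t₀).2, fn_scaleDeriv _ hq₁m ht₀,
    fn_scaleDeriv _ hq₂m ht₀]
  ring

/-! ### Absorbing the second block into the multiplier -/

variable {M : ℕ}

/-- The substitution of the second block read as extra riders. [folklore] -/
def subAbs (M n₂ : ℕ) (π : MvPolynomial (Fin M) ℚ) : Fin ((n₂ + M) + 1) → MvPolynomial (Fin (M + n₂)) ℚ :=
  Fin.lastCases (MvPolynomial.rename (Fin.castAdd n₂) π)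
    (Fin.addCases (fun j : Fin n₂ => X (Fin.natAdd M j)) (fun j : Fin M => X (Fin.castAdd n₂ j)))

/-- The point read by the absorbed block. [folklore] -/
def absPt (π : MvPolynomial (Fin M) ℚ) (w : Fin (M + n₂) → ℝ) : Fin ((n₂ + M) + 1) → ℝ :=
  Fin.snoc (Fin.append (fun j : Fin n₂ => w (Fin.natAdd M j)) (fun j : Fin M => w (Fin.castAdd n₂ j)))
    (aeval (fun i : Fin M => w (Fin.castAdd n₂ i)) π)

/-- Evaluating the absorbing substitution. [folklore] -/
theorem aeval_subAbs (π : MvPolynomial (Fin M) ℚ) (w : Fin (M + n₂) → ℝ) :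
    (fun i => aeval w (subAbs M n₂ π i)) = absPt π w := by
  funext i
  induction i using Fin.lastCases with
  | last => simp [subAbs, absPt, aeval_rename]; rfl
  | cast i =>
    simp only [subAbs, absPt, Fin.lastCases_castSucc, Fin.snoc_castSucc]
    induction i using Fin.addCases with
    | left j => simp
    | right j => simp

/-- The absorbed point lies in the cube. [folklore] -/
theorem absPt_mem {π : MvPolynomial (Fin M) ℚ} (hπ : IsScale (m := M) (k := 0) π) {w : Fin (M + n₂) → ℝ}
    (hw : w ∈ KZ.cube (M + n₂)) : absPt π w ∈ KZ.cube ((n₂ + M) + 1) := by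
  intro i
  induction i using Fin.lastCases with
  | last => simp only [absPt, Fin.snoc_last]; exact hπ _ fun i => hw _
  | cast i =>
    simp only [absPt, Fin.snoc_castSucc]
    induction i using Fin.addCases with
    | left j => simp only [Fin.append_left]; exact hw _
    | right j => simp only [Fin.append_right]; exact hw _

/-- Word coordinates of the absorbed point. [folklore] -/
@[simp] theorem wX_absPt (π : MvPolynomial (Fin M) ℚ) (w : Fin (M + n₂) → ℝ) (j : Fin n₂) :
    wX (absPt π w) j = w (Fin.natAdd M j) := by
  show (Fin.snoc _ _ : Fin ((n₂ + M) + 1) → ℝ) (Fin.castSucc (Fin.castAdd M j)) = _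
  rw [Fin.snoc_castSucc, Fin.append_left]

/-- Riders of the absorbed point. [folklore] -/
@[simp] theorem wRider_absPt (π : MvPolynomial (Fin M) ℚ) (w : Fin (M + n₂) → ℝ) :
    wRider (absPt (n₂ := n₂) π w) = fun j => w (Fin.castAdd n₂ j) := by
  funext j
  show (Fin.snoc _ _ : Fin ((n₂ + M) + 1) → ℝ) (Fin.castSucc (Fin.natAdd n₂ j)) = _
  rw [Fin.snoc_castSucc, Fin.append_right]

/-- Scale of the absorbed point. [folklore] -/
@[simp] theorem wScale_absPt (π : MvPolynomial (Fin M) ℚ) (w : Fin (M + n₂) → ℝ) :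
    wScale (absPt (n₂ := n₂) π w) = aeval (fun i : Fin M => w (Fin.castAdd n₂ i)) π := by
  show (Fin.snoc _ _ : Fin ((n₂ + M) + 1) → ℝ) (Fin.last _) = _
  rw [Fin.snoc_last]

/-- **Absorbing the second block**: the multiplier `ρ(e) · T₂(x₂; e; π(e))` over the riders
`(e, x₂)` (the block coordinates become extra riders). [folklore] -/
def absorbR (ρ : RFun M) (T₂ : RFun ((n₂ + M) + 1)) (π : MvPolynomial (Fin M) ℚ) (hπ : IsScale (m := M) (k := 0) π) :
    RFun (M + n₂) :=
  (⟨MvPolynomial.rename (Fin.castAdd n₂) ρ.num, MvPolynomial.rename (Fin.castAdd n₂) ρ.den, fun w hw => by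
      rw [aeval_rename]; exact ρ.den_ne _ fun i => hw _⟩ : RFun (M + n₂)).mul
    (T₂.subst (subAbs M n₂ π) fun w hw => by rw [aeval_subAbs]; exact absPt_mem hπ hw)

/-- Value of the absorbed multiplier. [folklore] -/
theorem fn_absorbR (ρ : RFun M) (T₂ : RFun ((n₂ + M) + 1)) (π : MvPolynomial (Fin M) ℚ) (hπ : IsScale (m := M) (k := 0) π)
    (w : Fin (M + n₂) → ℝ) :
    (absorbR ρ T₂ π hπ).fn w = ρ.fn (fun i => w (Fin.castAdd n₂ i)) * T₂.fn (absPt π w) := by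
  rw [absorbR, RFun.fn_mul, RFun.fn_subst, aeval_subAbs]
  congr 1
  simp only [RFun.fn, aeval_rename]
  rfl

/-- The scale read over the enlarged rider block. [folklore] -/
def liftPi (n₂ : ℕ) (π : MvPolynomial (Fin M) ℚ) : MvPolynomial (Fin (M + n₂)) ℚ := MvPolynomial.rename (Fin.castAdd n₂) π

/-- Evaluating the lifted scale. [folklore] -/
theorem aeval_liftPi (π : MvPolynomial (Fin M) ℚ) (w : Fin (M + n₂) → ℝ) :
    aeval w (liftPi n₂ π) = aeval (fun i => w (Fin.castAdd n₂ i)) π := by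
  rw [liftPi, aeval_rename]; rfl

/-- The lifted scale is a scale. [folklore] -/
theorem isScale_liftPi {π : MvPolynomial (Fin M) ℚ} (hπ : IsScale (m := M) (k := 0) π) :
    IsScale (m := M) (k := n₂) (liftPi n₂ π) := fun w hw => by
  rw [aeval_liftPi]; exact hπ _ fun i => hw _

/-- The block permutation `(x₁, x₂, e) ↦ (x₁, e, x₂)`. [folklore] -/
def midToEnd (a b c : ℕ) : Fin ((a + b) + c) ≃ Fin (a + (c + b)) :=
  finSumFinEquiv.symm.trans <| (Equiv.sumCongr finSumFinEquiv.symm (Equiv.refl _)).trans <|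
    (Equiv.sumAssoc _ _ _).trans <| (Equiv.sumCongr (Equiv.refl _) (Equiv.sumComm _ _)).trans <|
    (Equiv.sumCongr (Equiv.refl _) finSumFinEquiv).trans finSumFinEquiv

/-- `midToEnd⁻¹` on the first block. [folklore] -/
@[simp] theorem midToEnd_symm_left (a b c : ℕ) (j : Fin a) :
    (midToEnd a b c).symm (Fin.castAdd (c + b) j) = Fin.castAdd c (Fin.castAdd b j) := by
  simp [midToEnd]
/-- `midToEnd⁻¹` on the middle block. [folklore] -/
@[simp] theorem midToEnd_symm_mid (a b c : ℕ) (j : Fin c) :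
    (midToEnd a b c).symm (Fin.natAdd a (Fin.castAdd b j)) = Fin.natAdd (a + b) j := by
  simp [midToEnd]
/-- `midToEnd⁻¹` on the last block. [folklore] -/
@[simp] theorem midToEnd_symm_right (a b c : ℕ) (j : Fin b) :
    (midToEnd a b c).symm (Fin.natAdd a (Fin.natAdd c j)) = Fin.castAdd c (Fin.natAdd a j) := by
  simp [midToEnd]

include hrel in
/-- **The absorption identity**: `⟪ρ · (S ⊠ T₂)[π]⟫ = ⟪(absorb ρ T₂ π) · S[π↑]⟫ — the second block
read as extra riders (a coordinate permutation). [folklore] -/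
theorem chi_famTerm_boxT_absorb (ρ : RFun M) (S : RFun ((n₁ + M) + 1)) (T₂ : RFun ((n₂ + M) + 1))
    (π : MvPolynomial (Fin M) ℚ) (hπ : IsScale (m := M) (k := 0) π) :
    (famTerm (m := M) (k := 0) ρ (boxT S T₂) π hπ).chi χ =
      (famTerm (m := M) (k := n₂) (absorbR ρ T₂ π hπ) S (liftPi n₂ π) (isScale_liftPi hπ)).chi χ := by
  set G : RFun (n₁ + (M + n₂)) := famTerm (m := M) (k := n₂) (absorbR ρ T₂ π hπ) S (liftPi n₂ π) (isScale_liftPi hπ)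
    with hG
  rw [← RFun.chi_rename hrel G (midToEnd n₁ n₂ M).symm]
  refine RFun.chi_congr hrel fun y _ => ?_
  rw [RFun.fn_rename, fn_famTerm, fn_boxT, hG, fn_famTerm, fn_absorbR]
  -- identify the three points
  have hρ : (fun i : Fin M => (y ∘ (midToEnd n₁ n₂ M).symm) (Fin.natAdd n₁ (Fin.castAdd n₂ i))) =
      fun i => y (Fin.natAdd (n₁ + n₂) i) := by
    funext i; simp only [Function.comp_apply, midToEnd_symm_mid]
  have hS : famPt n₁ (liftPi n₂ π) (y ∘ (midToEnd n₁ n₂ M).symm) = projB₁ (famPt (n₁ + n₂) (m := M) (k := 0) π y) := by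
    apply layout_ext
    · funext j
      rw [wX_famPt, wX_projB₁, wX_famPt, Function.comp_apply, midToEnd_symm_left]
      rfl
    · funext j
      rw [wRider_famPt, wRider_projB₁, wRider_famPt, Function.comp_apply, midToEnd_symm_mid]
      rfl
    · rw [wScale_famPt, wScale_projB₁, wScale_famPt, aeval_liftPi, hρ]
  have hT : absPt π (fun i : Fin (M + n₂) => (y ∘ (midToEnd n₁ n₂ M).symm) (Fin.natAdd n₁ i)) =
      projB₂ (famPt (n₁ + n₂) (m := M) (k := 0) π y) := by
    apply layout_ext
    · funext j
      rw [wX_absPt, wX_projB₂, wX_famPt, Function.comp_apply, midToEnd_symm_right]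
      rfl
    · rw [wRider_absPt, wRider_projB₂]
      funext j
      rw [wRider_famPt, Function.comp_apply, midToEnd_symm_mid]
      rfl
    · rw [wScale_absPt, wScale_projB₂, wScale_famPt, hρ]
  rw [hρ, hS, hT]
  ring

/-- Absorption commutes with rider-and-scale multipliers. [folklore] -/
theorem fn_absorbR_mul_scaleFam (ρ : RFun M) (T₂ : RFun ((n₂ + M) + 1)) (π : MvPolynomial (Fin M) ℚ)
    (hπ : IsScale (m := M) (k := 0) π) (g : RFun (M + 1)) (w : Fin (M + n₂) → ℝ) :
    ((absorbR ρ T₂ π hπ).mul (scaleFam (m := M) (k := n₂) g (liftPi n₂ π) (isScale_liftPi hπ))).fn w =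
      (absorbR (ρ.mul (scaleFam (m := M) (k := 0) g π hπ)) T₂ π hπ).fn w := by
  rw [RFun.fn_mul, fn_absorbR, fn_absorbR, RFun.fn_mul, fn_scaleFam, fn_scaleFam, aeval_liftPi]
  have : (fun j : Fin M => w (Fin.castAdd n₂ j)) = fun j : Fin M => (fun i : Fin M => w (Fin.castAdd n₂ i)) (Fin.castAdd 0 j) := by
    funext j; rfl
  rw [this]
  ring

/-! ### Swapping the blocks -/

/-- The block swap `(x₁, x₂, e) ↦ (x₂, x₁, e)`. [folklore] -/
def swapBlocks (a b c : ℕ) : Fin ((a + b) + c) ≃ Fin ((b + a) + c) :=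
  finSumFinEquiv.symm.trans <| (Equiv.sumCongr (finSumFinEquiv.symm.trans ((Equiv.sumComm _ _).trans finSumFinEquiv))
    (Equiv.refl _)).trans finSumFinEquiv

/-- `swapBlocks⁻¹` on the first block. [folklore] -/
@[simp] theorem swapBlocks_symm_left (a b c : ℕ) (j : Fin b) :
    (swapBlocks a b c).symm (Fin.castAdd c (Fin.castAdd a j)) = Fin.castAdd c (Fin.natAdd a j) := by
  simp [swapBlocks]
/-- `swapBlocks⁻¹` on the second block. [folklore] -/
@[simp] theorem swapBlocks_symm_right (a b c : ℕ) (j : Fin a) :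
    (swapBlocks a b c).symm (Fin.castAdd c (Fin.natAdd b j)) = Fin.castAdd c (Fin.castAdd b j) := by
  simp [swapBlocks]
/-- `swapBlocks⁻¹` on the tail block. [folklore] -/
@[simp] theorem swapBlocks_symm_tail (a b c : ℕ) (j : Fin c) :
    (swapBlocks a b c).symm (Fin.natAdd (b + a) j) = Fin.natAdd (a + b) j := by
  simp [swapBlocks]

include hrel in
/-- **Swapping the blocks** does not change the class: `⟪ρ · (T₁ ⊠ T₂)[π]⟫ = ⟪ρ · (T₂ ⊠ T₁)[π]⟫`. [folklore] -/
theorem chi_famTerm_boxT_swap (ρ : RFun (M + k)) (T₁ : RFun ((n₁ + M) + 1)) (T₂ : RFun ((n₂ + M) + 1))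
    (π : MvPolynomial (Fin (M + k)) ℚ) (hπ : IsScale π) :
    (famTerm ρ (boxT T₁ T₂) π hπ).chi χ = (famTerm ρ (boxT T₂ T₁) π hπ).chi χ := by
  rw [← RFun.chi_rename hrel (famTerm ρ (boxT T₂ T₁) π hπ) (swapBlocks n₁ n₂ (M + k)).symm]
  refine RFun.chi_congr hrel fun y _ => ?_
  rw [RFun.fn_rename, fn_famTerm, fn_boxT, fn_famTerm, fn_boxT]
  have hρ : (fun i : Fin (M + k) => (y ∘ (swapBlocks n₁ n₂ (M + k)).symm) (Fin.natAdd (n₂ + n₁) i)) =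
      fun i => y (Fin.natAdd (n₁ + n₂) i) := by
    funext i; simp only [Function.comp_apply, swapBlocks_symm_tail]
  have h1 : projB₁ (famPt (n₂ + n₁) π (y ∘ (swapBlocks n₁ n₂ (M + k)).symm)) = projB₂ (famPt (n₁ + n₂) π y) := by
    apply layout_ext
    · funext j
      rw [wX_projB₁, wX_projB₂, wX_famPt, wX_famPt, Function.comp_apply, swapBlocks_symm_left]
    · rw [wRider_projB₁, wRider_projB₂]
      funext j
      rw [wRider_famPt, wRider_famPt, Function.comp_apply, swapBlocks_symm_tail]
    · rw [wScale_projB₁, wScale_projB₂, wScale_famPt, wScale_famPt, hρ]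
  have h2 : projB₂ (famPt (n₂ + n₁) π (y ∘ (swapBlocks n₁ n₂ (M + k)).symm)) = projB₁ (famPt (n₁ + n₂) π y) := by
    apply layout_ext
    · funext j
      rw [wX_projB₂, wX_projB₁, wX_famPt, wX_famPt, Function.comp_apply, swapBlocks_symm_right]
    · rw [wRider_projB₂, wRider_projB₁]
      funext j
      rw [wRider_famPt, wRider_famPt, Function.comp_apply, swapBlocks_symm_tail]
    · rw [wScale_projB₂, wScale_projB₁, wScale_famPt, wScale_famPt, hρ]
  rw [hρ, h1, h2]
  ring

end Joint


/-! ## The diagonal rider Stokes move: scale and transverse rider tied -/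

end Literature.NumberTheory.Transcendental.KZ.Cube

namespace Literature.NumberTheory.Transcendental.KZ

variable {M M' m n k N : ℕ}



namespace RFun

/-- **Chain rule** for a regular rational function along a real path whose point has a
non-vanishing denominator. [folklore] -/
theorem hasDerivAt_fn_comp {N : ℕ} (T : RFun N) {γ : ℝ → (Fin N → ℝ)} {γ' : Fin N → ℝ} {t : ℝ}
    (hγ : ∀ i, HasDerivAt (fun u => γ u i) (γ' i) t) (hden : aeval (γ t) T.den ≠ 0) :
    HasDerivAt (fun u => T.fn (γ u)) (∑ i, (T.pd i).fn (γ t) * γ' i) t := by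
  have h := (hasDerivAt_aeval_comp_real hγ T.num).div (hasDerivAt_aeval_comp_real hγ T.den) hden
  have hval : (∑ i, (T.pd i).fn (γ t) * γ' i) =
      ((∑ i, aeval (γ t) (pderiv i T.num) * γ' i) * aeval (γ t) T.den -
        aeval (γ t) T.num * ∑ i, aeval (γ t) (pderiv i T.den) * γ' i) / aeval (γ t) T.den ^ 2 := by
    simp only [fn, pd, map_sub, map_mul, map_pow]
    rw [Finset.sum_mul, Finset.mul_sum, ← Finset.sum_sub_distrib, Finset.sum_div]
    refine Finset.sum_congr rfl fun i _ => ?_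
    field_simp
  rw [hval]
  exact h

end RFun

end Literature.NumberTheory.Transcendental.KZ

namespace Literature.NumberTheory.Transcendental.KZ.Cube

variable {M N : ℕ}

section DiagS

variable {R : Type} [CommRing R] {χ : KZ.FormalRep →+ R} (hrel : ∀ c ∈ KZ.relations, χ c = 0)
variable {m n k : ℕ}

/-- Multiplication by the transverse rider `Y`. [folklore] -/
def smulY (S : RFun ((n + (m + 1)) + 1)) : RFun ((n + (m + 1)) + 1) := (RFun.poly (X (iY n m))).mul S

/-- Value of `smulY`. [folklore] -/
theorem fn_smulY (S : RFun ((n + (m + 1)) + 1)) (z : Fin ((n + (m + 1)) + 1) → ℝ) :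
    (smulY S).fn z = z (iY n m) * S.fn z := by
  rw [smulY, RFun.fn_mul, RFun.fn_poly, aeval_X]

/-- The diagonal curve in the word layout of `T`: word coordinates and letter riders of `y`,
transverse rider and scale both equal to `a s`. [folklore] -/
def curvePt (y : Fin (n + (m + k)) → ℝ) (a s : ℝ) : Fin ((n + (m + 1)) + 1) → ℝ :=
  Fin.snoc (Fin.append (fun j : Fin n => y (Fin.castAdd (m + k) j))
    (Fin.snoc (fun j : Fin m => y (Fin.natAdd n (Fin.castAdd k j))) (a * s))) (a * s)

/-- Layout of the diagonal curve. [folklore] -/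
theorem curvePt_layout (y : Fin (n + (m + k)) → ℝ) (a s : ℝ) :
    wX (curvePt y a s) = (fun j : Fin n => y (Fin.castAdd (m + k) j)) ∧
      wRider (curvePt y a s) = Fin.snoc (fun j : Fin m => y (Fin.natAdd n (Fin.castAdd k j))) (a * s) ∧
      wScale (curvePt y a s) = a * s := by
  refine ⟨?_, ?_, ?_⟩
  · funext j
    show (Fin.snoc _ _ : Fin ((n + (m + 1)) + 1) → ℝ) (Fin.castSucc (Fin.castAdd (m + 1) j)) = _
    rw [Fin.snoc_castSucc, Fin.append_left]
  · funext j
    show (Fin.snoc _ _ : Fin ((n + (m + 1)) + 1) → ℝ) (Fin.castSucc (Fin.natAdd n j)) = _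
    rw [Fin.snoc_castSucc, Fin.append_right]
  · show (Fin.snoc _ _ : Fin ((n + (m + 1)) + 1) → ℝ) (Fin.last _) = _
    rw [Fin.snoc_last]

/-- The transverse coordinate of the diagonal curve. [folklore] -/
theorem curvePt_iY (y : Fin (n + (m + k)) → ℝ) (a s : ℝ) : curvePt y a s (iY n m) = a * s := by
  have := congrFun (curvePt_layout y a s).2.1 (Fin.last m)
  rw [Fin.snoc_last] at this
  exact this

/-- Riders of a `snoc` point of the family layout. [folklore] -/
theorem riders_snoc (y : Fin (n + (m + k)) → ℝ) (s : ℝ) :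
    (fun i : Fin (m + (k + 1)) => (Fin.snoc y s : Fin ((n + (m + k)) + 1) → ℝ) (Fin.natAdd n i)) =
      Fin.snoc (fun i : Fin (m + k) => y (Fin.natAdd n i)) s := by
  funext i
  induction i using Fin.lastCases with
  | last =>
    show (Fin.snoc y s : Fin ((n + (m + k)) + 1) → ℝ) (Fin.last _) =
      (Fin.snoc (fun i : Fin (m + k) => y (Fin.natAdd n i)) s : Fin ((m + k) + 1) → ℝ) (Fin.last (m + k))
    rw [Fin.snoc_last, Fin.snoc_last]
  | cast i =>
    show (Fin.snoc y s : Fin ((n + (m + k)) + 1) → ℝ) (Fin.castSucc (Fin.natAdd n i)) =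
      (Fin.snoc (fun i : Fin (m + k) => y (Fin.natAdd n i)) s : Fin ((m + k) + 1) → ℝ) (Fin.castSucc i)
    rw [Fin.snoc_castSucc, Fin.snoc_castSucc]

/-- Riders of the family point of a `snoc` point (all riders are letter riders). [folklore] -/
theorem wRider_famPt_snoc (π : MvPolynomial (Fin (m + k)) ℚ) (y : Fin (n + (m + k)) → ℝ) (s : ℝ) :
    wRider (famPt (m := m + (k + 1)) (k := 0) n (scaleMul π) (Fin.snoc y s : Fin ((n + (m + k)) + 1) → ℝ)) =
      Fin.snoc (fun i : Fin (m + k) => y (Fin.natAdd n i)) s := by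
  funext j
  rw [wRider_famPt]
  exact congrFun (riders_snoc y s) j

/-- The diagonal point read by the tied family. [folklore] -/
theorem yPt_famPt_snoc (π : MvPolynomial (Fin (m + k)) ℚ) (y : Fin (n + (m + k)) → ℝ) (s : ℝ) :
    yPt n (scaleMul π) (famPt (m := m + (k + 1)) (k := 0) n (scaleMul π) (Fin.snoc y s : Fin ((n + (m + k)) + 1) → ℝ)) =
      curvePt y (aeval (fun i => y (Fin.natAdd n i)) π) s := by
  have hsc : ∀ r : Fin (m + k) → ℝ, aeval (Fin.snoc r s : Fin (m + (k + 1)) → ℝ) (scaleMul π) = aeval r π * s := by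
    intro r
    rw [aeval_scaleMul]
    show aeval (Fin.init (Fin.snoc r s : Fin ((m + k) + 1) → ℝ)) π * (Fin.snoc r s : Fin ((m + k) + 1) → ℝ) (Fin.last (m + k)) = _
    rw [Fin.init_snoc, Fin.snoc_last]
  apply layout_ext
  · rw [wX_yPt, (curvePt_layout _ _ _).1]
    funext j
    rw [wX_famPt]
    show (Fin.snoc y s : Fin ((n + (m + k)) + 1) → ℝ) (Fin.castSucc (Fin.castAdd (m + k) j)) = _
    rw [Fin.snoc_castSucc]
  · rw [wRider_yPt, (curvePt_layout _ _ _).2.1, wRider_famPt_snoc]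
    erw [hsc]
    congr 1
    funext j
    show (Fin.snoc (fun i : Fin (m + k) => y (Fin.natAdd n i)) s : Fin (m + (k + 1)) → ℝ) (Fin.castSucc (Fin.castAdd k j)) = _
    rw [Fin.snoc_castSucc]
  · rw [wScale_yPt, (curvePt_layout _ _ _).2.2, wScale_famPt]
    erw [riders_snoc, hsc]

/-- The diagonal curve stays in the cube. [folklore] -/
theorem curvePt_mem {y : Fin (n + (m + k)) → ℝ} (hy : y ∈ KZ.cube (n + (m + k))) {a s : ℝ} (has : a * s ∈ Icc (0 : ℝ) 1) :
    curvePt y a s ∈ KZ.cube ((n + (m + 1)) + 1) := by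
  intro i
  induction i using Fin.lastCases with
  | last => rw [curvePt, Fin.snoc_last]; exact has
  | cast i =>
    rw [curvePt, Fin.snoc_castSucc]
    induction i using Fin.addCases with
    | left j => rw [Fin.append_left]; exact hy _
    | right j =>
      rw [Fin.append_right]
      induction j using Fin.lastCases with
      | last => rw [Fin.snoc_last]; exact has
      | cast j => rw [Fin.snoc_castSucc]; exact hy _

/-- The derivative of the diagonal curve. [folklore] -/
theorem hasDerivAt_curvePt (y : Fin (n + (m + k)) → ℝ) (a s₀ : ℝ) :
    ∀ i, HasDerivAt (fun s => curvePt y a s i)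
      ((Fin.snoc (Fin.append (fun _ : Fin n => (0 : ℝ)) (Fin.snoc (fun _ : Fin m => (0 : ℝ)) a)) a :
        Fin ((n + (m + 1)) + 1) → ℝ) i) s₀ := by
  intro i
  induction i using Fin.lastCases with
  | last =>
    simp only [curvePt, Fin.snoc_last]
    simpa using (hasDerivAt_id s₀).const_mul a
  | cast i =>
    simp only [curvePt, Fin.snoc_castSucc]
    induction i using Fin.addCases with
    | left j => simp only [Fin.append_left]; exact hasDerivAt_const _ _
    | right j =>
      simp only [Fin.append_right]
      induction j using Fin.lastCases with
      | last => simp only [Fin.snoc_last]; simpa using (hasDerivAt_id s₀).const_mul a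
      | cast j => simp only [Fin.snoc_castSucc]; exact hasDerivAt_const _ _

/-- The chain-rule sum along the diagonal curve: `a (∂_Y T + ∂_τ T)`. [folklore] -/
theorem sum_pd_curve (T : RFun ((n + (m + 1)) + 1)) (z : Fin ((n + (m + 1)) + 1) → ℝ) (a : ℝ) :
    (∑ i, (T.pd i).fn z * (Fin.snoc (Fin.append (fun _ : Fin n => (0 : ℝ)) (Fin.snoc (fun _ : Fin m => (0 : ℝ)) a)) a :
        Fin ((n + (m + 1)) + 1) → ℝ) i) = a * ((pdY T).fn z + T.dlast.fn z) := by
  rw [Fin.sum_univ_castSucc, Fin.snoc_last, Fin.sum_univ_add]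
  simp only [Fin.snoc_castSucc, Fin.append_left, Fin.append_right, mul_zero, Finset.sum_const_zero, zero_add,
    Fin.sum_univ_castSucc, Fin.snoc_last, RFun.pd_last]
  rw [pdY, iY]
  ring

include hrel

/-- **The diagonal rider Stokes move.** For a word function `T` with a transverse rider `Y`, read
with `Y` and the scale both equal to the rider scale `π`:
`⟪ρ · T[Y:=π][π]⟫ = ⟪ρ⁺ · (∂_τ(τT))[Y:=πv][πv]⟫ + ⟪ρ⁺ · (Y∂_Y T)[Y:=πv][πv]⟫`
(Stokes along the new rider `v` for `F = ρ v T[Y := πv][πv]`). [cite: KontsevichZagier2001, §1.2 rule (3)] -/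
theorem chi_famTerm_famY_diag (ρ : RFun (m + k)) (T : RFun ((n + (m + 1)) + 1)) (π : MvPolynomial (Fin (m + k)) ℚ)
    (hπ : IsScale π) :
    (famTerm (m := m + k) (k := 0) ρ (famY T π hπ) π hπ).chi χ =
      (famTerm (m := m + (k + 1)) (k := 0) ρ.lift (famY (k := k + 1) (scaleDeriv T) (scaleMul π) (isScale_scaleMul hπ))
          (scaleMul π) (isScale_scaleMul hπ)).chi χ +
        (famTerm (m := m + (k + 1)) (k := 0) ρ.lift (famY (k := k + 1) (smulY (pdY T)) (scaleMul π) (isScale_scaleMul hπ))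
          (scaleMul π) (isScale_scaleMul hπ)).chi χ := by
  have hπ' := isScale_scaleMul hπ
  -- the homotopy `F(y, v) = ρ(y) · v · T[Y := π(y)v](…, π(y)v)`
  set F : RFun ((n + (m + k)) + 1) :=
    ((ρ.pre n).lift).mul ((RFun.poly (X (Fin.last (n + (m + k))))).mul
      (fam (m := m + (k + 1)) (k := 0) (famY (k := k + 1) T (scaleMul π) hπ') (scaleMul π) hπ')) with hF
  have hst := RFun.chi_stokesAt hrel (Fin.last _) F
  -- values of `F` and of the two derived families on vertical fibres
  have hFval : ∀ (y : Fin (n + (m + k)) → ℝ) (v : ℝ), F.fn (Fin.snoc y v) =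
      ρ.fn (fun i => y (Fin.natAdd n i)) * (v * T.fn (curvePt y (aeval (fun i => y (Fin.natAdd n i)) π) v)) := by
    intro y v
    rw [hF, RFun.fn_mul, RFun.fn_lift_snoc, RFun.fn_pre, RFun.fn_mul, RFun.fn_poly, aeval_X, Fin.snoc_last, fn_fam,
      fn_famY, yPt_famPt_snoc]
  have hGval : ∀ (X : RFun ((n + (m + 1)) + 1)) (y : Fin (n + (m + k)) → ℝ) (v : ℝ),
      (famTerm (m := m + (k + 1)) (k := 0) ρ.lift (famY (k := k + 1) X (scaleMul π) hπ') (scaleMul π) hπ').fn (Fin.snoc y v) =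
        ρ.fn (fun i => y (Fin.natAdd n i)) * X.fn (curvePt y (aeval (fun i => y (Fin.natAdd n i)) π) v) := by
    intro X y v
    rw [fn_famTerm, RFun.fn_lift, fn_famY, yPt_famPt_snoc]
    erw [riders_snoc]
    rw [Fin.init_snoc]
  -- face `v = 1`
  have e1 : (F.faceAt (Fin.last _) 1 ⟨zero_le_one, le_rfl⟩).chi χ = (famTerm (m := m + k) (k := 0) ρ (famY T π hπ) π hπ).chi χ := by
    refine RFun.chi_congr hrel fun y _ => ?_
    rw [RFun.fn_faceAt, Fin.insertNth_last', fn_famTerm, fn_famY]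
    push_cast
    rw [hFval, one_mul]
    have hpt : curvePt y (aeval (fun i => y (Fin.natAdd n i)) π) 1 = yPt n π (famPt (m := m + k) (k := 0) n π y) := by
      apply layout_ext
      · rw [(curvePt_layout _ _ _).1, wX_yPt]; funext j; rw [wX_famPt]; rfl
      · rw [(curvePt_layout _ _ _).2.1, wRider_yPt, mul_one]
        have hrid : wRider (famPt (m := m + k) (k := 0) n π y) = fun i => y (Fin.natAdd n i) := by
          funext j; rw [wRider_famPt]; rfl
        rw [hrid]
      · rw [(curvePt_layout _ _ _).2.2, wScale_yPt, wScale_famPt, mul_one]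
        rfl
    rw [hpt]
    rfl
  -- face `v = 0`
  have e0 : (F.faceAt (Fin.last _) 0 ⟨le_rfl, zero_le_one⟩).chi χ = 0 := by
    refine RFun.chi_eq_zero hrel fun y _ => ?_
    rw [RFun.fn_faceAt, Fin.insertNth_last']
    push_cast
    rw [hFval, zero_mul, mul_zero]
  -- the derivative
  have ed : (F.pd (Fin.last _)).chi χ =
      (famTerm (m := m + (k + 1)) (k := 0) ρ.lift (famY (k := k + 1) (scaleDeriv T) (scaleMul π) hπ') (scaleMul π) hπ').chi χ +
      (famTerm (m := m + (k + 1)) (k := 0) ρ.lift (famY (k := k + 1) (smulY (pdY T)) (scaleMul π) hπ') (scaleMul π) hπ').chi χ := by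
    rw [← RFun.chi_add hrel]
    refine RFun.chi_congr hrel fun w hw => ?_
    have hw' : w = Fin.snoc (Fin.init w) (w (Fin.last _)) := (Fin.snoc_init_self w).symm
    set y : Fin (n + (m + k)) → ℝ := Fin.init w with hy_def
    set v : ℝ := w (Fin.last _) with hv_def
    have hy : y ∈ KZ.cube (n + (m + k)) := fun i => hw (Fin.castSucc i)
    have hv : v ∈ Icc (0 : ℝ) 1 := ⟨(hw _).1, (hw _).2⟩
    rw [hw', RFun.fn_add (KZ.snoc_mem_cube_iff.2 ⟨hy, hv.1, hv.2⟩), hGval, hGval]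
    set r : Fin (m + k) → ℝ := fun i => y (Fin.natAdd n i) with hr
    set a : ℝ := aeval r π with ha_def
    have hr_mem : r ∈ KZ.cube (m + k) := fun i => hy _
    have ha : 0 ≤ a ∧ a ≤ 1 := hπ r hr_mem
    have hav : a * v ∈ Icc (0 : ℝ) 1 := ⟨mul_nonneg ha.1 hv.1, mul_le_one₀ ha.2 hv.1 hv.2⟩
    have hγmem : curvePt y a v ∈ KZ.cube ((n + (m + 1)) + 1) := curvePt_mem hy hav
    -- LHS: the actual `v`-derivative of `F`
    have hL : HasDerivAt (fun s : ℝ => F.fn (Fin.snoc y s)) ((F.pd (Fin.last _)).fn (Fin.snoc y v)) v := by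
      rw [RFun.pd_last]; exact F.hasDerivAt_fn_snoc hy hv
    have hfunF : (fun s : ℝ => F.fn (Fin.snoc y s)) = fun s => ρ.fn r * (s * T.fn (curvePt y a s)) := by
      funext s; rw [hFval]
    rw [hfunF] at hL
    have hT : HasDerivAt (fun s : ℝ => T.fn (curvePt y a s)) (a * ((pdY T).fn (curvePt y a v) + T.dlast.fn (curvePt y a v))) v := by
      rw [← sum_pd_curve T (curvePt y a v) a]
      exact T.hasDerivAt_fn_comp (hasDerivAt_curvePt y a v) (T.den_ne _ hγmem)
    have hR : HasDerivAt (fun s : ℝ => ρ.fn r * (s * T.fn (curvePt y a s)))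
        (ρ.fn r * (1 * T.fn (curvePt y a v) + v * (a * ((pdY T).fn (curvePt y a v) + T.dlast.fn (curvePt y a v))))) v :=
      ((hasDerivAt_id v).mul hT).const_mul (ρ.fn r)
    rw [hL.unique hR]
    -- RHS values
    have hsplit : curvePt y a v = Fin.snoc (Fin.init (curvePt y a v)) (a * v) := by
      conv_lhs => rw [← Fin.snoc_init_self (curvePt y a v)]
      rw [show curvePt y a v (Fin.last _) = a * v from (curvePt_layout y a v).2.2]
    have hp : Fin.init (curvePt y a v) ∈ KZ.cube (n + (m + 1)) := fun i => hγmem _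
    rw [fn_smulY, curvePt_iY]
    conv_rhs => rw [hsplit, fn_scaleDeriv T hp hav, ← hsplit]
    ring
  rw [← e1, ← ed, hst, e0, sub_zero]

end DiagS


/-! ## Substituting the transverse rider in direction data; the bridges to tied families -/

section SubstY

variable {ι : Type} {m n k : ℕ}

namespace DirData

/-- **Substituting the transverse rider** `Y := Υ(e)` in direction data whose letters depend on a
transverse rider `Y` (the last of `m + 1` riders). [folklore] -/
def substY (Δ₁ : DirData ι (m + 1)) (Υ : MvPolynomial (Fin (m + k)) ℚ) (hΥ : IsScale Υ) : DirData ι (m + k) where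
  c := Δ₁.c
  hc := Δ₁.hc
  N := fun ℓ => bind₁ (riderSubstY Υ) (Δ₁.N ℓ)
  M := fun ℓ => bind₁ (riderSubstY Υ) (Δ₁.M ℓ)
  N' := fun ℓ => bind₁ (riderSubstY Υ) (Δ₁.N' ℓ)
  M' := fun ℓ => bind₁ (riderSubstY Υ) (Δ₁.M' ℓ)
  reg := fun ℓ => Letter.isRegular_substY hΥ (Letter.reg (Δ₁.N ℓ) (Δ₁.M ℓ)) (Δ₁.reg ℓ)

/-- The letters of the substituted data are the substituted letters. [folklore] -/
theorem substY_d (Δ₁ : DirData ι (m + 1)) (Υ : MvPolynomial (Fin (m + k)) ℚ) (hΥ : IsScale Υ) :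
    (Δ₁.substY Υ hΥ).d = fun a => (Δ₁.d a).substY Υ := by
  funext a; cases a <;> rfl

/-- **Transverse derivative data** of `Y`-dependent direction data: `N' = Y ∂_Y N`, `M' = Y ∂_Y M`. [folklore] -/
def IsDeriv (Δ₁ : DirData ι (m + 1)) : Prop :=
  ∀ ℓ, Δ₁.N' ℓ = X (Fin.last m) * pderiv (Fin.last m) (Δ₁.N ℓ) ∧ Δ₁.M' ℓ = X (Fin.last m) * pderiv (Fin.last m) (Δ₁.M ℓ)

end DirData

/-- `Zw` only depends on the letter data (the regularity proofs are irrelevant). [folklore] -/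
theorem Zw_congr_d {c : ℚ} {hc : 0 ≤ c} {d₁ d₂ : ι → Letter m} (h : d₁ = d₂) (hd₁ : ∀ a, (d₁ a).IsRegular c)
    (hd₂ : ∀ a, (d₂ a).IsRegular c) (v : List ι) : Zw c hc d₁ hd₁ v = Zw c hc d₂ hd₂ v := by
  subst h; rfl

/-- **The `Z`-bridge**: the tied word function is the word function of the substituted data. [folklore] -/
theorem fn_famY_Zw_substY (Δ₁ : DirData ι (m + 1)) (Υ : MvPolynomial (Fin (m + k)) ℚ) (hΥ : IsScale Υ)
    (w : List (Option ι)) {z : Fin ((w.length + (m + k)) + 1) → ℝ} (hz : z ∈ KZ.cube ((w.length + (m + k)) + 1)) :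
    (famY (Zw Δ₁.c Δ₁.hc Δ₁.d Δ₁.hd w) Υ hΥ).fn z =
      (Zw (Δ₁.substY Υ hΥ).c (Δ₁.substY Υ hΥ).hc (Δ₁.substY Υ hΥ).d (Δ₁.substY Υ hΥ).hd w).fn z := by
  rw [fn_famY_Zw Δ₁.c Δ₁.hc Δ₁.d Δ₁.hd hΥ w z hz]
  rw [Zw_congr_d (Δ₁.substY_d Υ hΥ).symm]
  rfl

/-! ### The transverse derivative of the letter factors -/

/-- Derivative of a rider polynomial along the transverse rider. [folklore] -/
theorem hasDerivAt_aeval_snoc_last (P : MvPolynomial (Fin (m + 1)) ℚ) (r : Fin (m + 1) → ℝ) :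
    HasDerivAt (fun Y : ℝ => aeval (Function.update r (Fin.last m) Y) P)
      (aeval r (pderiv (Fin.last m) P)) (r (Fin.last m)) := by
  have h := hasDerivAt_aeval_update P r (Fin.last m) (r (Fin.last m))
  rwa [Function.update_eq_self] at h

/-- **`∂_Y` of the head factor** of a regular letter:
`∂_Y [N u/(N u + M)] = u (N_Y M − N M_Y)/(N u + M)²`. [folklore] -/
theorem fn_pd_headS_reg (c : ℚ) (hc : 0 ≤ c) (N M : MvPolynomial (Fin (m + 1)) ℚ) (h : (Letter.reg N M).IsRegular c)
    {w : Fin ((m + 1) + 1) → ℝ} (hw : w ∈ KZ.cube ((m + 1) + 1)) :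
    ((headS c hc (Letter.reg N M) h).pd (iYs m)).fn w =
      (c * w (Fin.last (m + 1))) * (aeval (Fin.init w) (pderiv (Fin.last m) N) * aeval (Fin.init w) M -
        aeval (Fin.init w) N * aeval (Fin.init w) (pderiv (Fin.last m) M)) /
      (aeval (Fin.init w) N * (c * w (Fin.last (m + 1))) + aeval (Fin.init w) M) ^ 2 := by
  set r := Fin.init w with hr
  set u : ℝ := c * w (Fin.last (m + 1)) with hu
  have hτ : 0 ≤ w (Fin.last (m + 1)) ∧ w (Fin.last (m + 1)) ≤ 1 := hw _
  have hc' : (0 : ℝ) ≤ c := by exact_mod_cast hc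
  have hden : aeval r N * u + aeval r M ≠ 0 :=
    h r (fun i => hw _) u (mul_nonneg hc' hτ.1) (by simpa [hu] using mul_le_mul_of_nonneg_left hτ.2 hc')
  -- the function along the `Y`-fibre
  have hupd : ∀ Y : ℝ, Fin.init (Function.update w (iYs m) Y) = Function.update r (Fin.last m) Y ∧
      Function.update w (iYs m) Y (Fin.last (m + 1)) = w (Fin.last (m + 1)) := by
    intro Y
    constructor
    · funext j
      by_cases hj : j = Fin.last m
      · subst hj
        rw [Function.update_self]
        exact Function.update_self (iYs m) Y w
      · rw [Function.update_of_ne hj]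
        show Function.update w (iYs m) Y (Fin.castSucc j) = w (Fin.castSucc j)
        rw [Function.update_of_ne (show Fin.castSucc j ≠ iYs m from fun h' => hj (Fin.castSucc_injective _ h'))]
    · rw [Function.update_of_ne]
      exact fun h' => by have := congrArg Fin.val h'; simp [iYs] at this
  have hfun : (fun Y : ℝ => (headS c hc (Letter.reg N M) h).fn (Function.update w (iYs m) Y)) =
      fun Y => aeval (Function.update r (Fin.last m) Y) N * u / (aeval (Function.update r (Fin.last m) Y) N * u +
        aeval (Function.update r (Fin.last m) Y) M) := by
    funext Y; rw [fn_headS, (hupd Y).1, (hupd Y).2, Letter.cR_reg]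
  have h1 := (headS c hc (Letter.reg N M) h).hasDerivAt_fn_update hw (iYs m)
  rw [hfun, show w (iYs m) = r (Fin.last m) from rfl] at h1
  have hN := hasDerivAt_aeval_snoc_last N r
  have hM := hasDerivAt_aeval_snoc_last M r
  have h2 := (hN.mul_const u).div ((hN.mul_const u).add hM)
    (by simp only [Pi.add_apply, Function.update_eq_self]; exact hden)
  have hd := h1.unique h2
  simp only [Pi.add_apply, Function.update_eq_self] at hd
  rw [hd]
  field_simp
  ring

/-- **`∂_Y` of the last factor** of a regular letter: `∂_Y [N/(N u + M)] = (N_Y M − N M_Y)/(N u + M)²`. [folklore] -/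
theorem fn_pd_lastS_reg (c : ℚ) (hc : 0 ≤ c) (N M : MvPolynomial (Fin (m + 1)) ℚ) (h : (Letter.reg N M).IsRegular c)
    {w : Fin ((m + 1) + 1) → ℝ} (hw : w ∈ KZ.cube ((m + 1) + 1)) :
    ((lastS c hc (Letter.reg N M) h).pd (iYs m)).fn w =
      (aeval (Fin.init w) (pderiv (Fin.last m) N) * aeval (Fin.init w) M -
        aeval (Fin.init w) N * aeval (Fin.init w) (pderiv (Fin.last m) M)) /
      (aeval (Fin.init w) N * (c * w (Fin.last (m + 1))) + aeval (Fin.init w) M) ^ 2 := by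
  set r := Fin.init w with hr
  set u : ℝ := c * w (Fin.last (m + 1)) with hu
  have hτ : 0 ≤ w (Fin.last (m + 1)) ∧ w (Fin.last (m + 1)) ≤ 1 := hw _
  have hc' : (0 : ℝ) ≤ c := by exact_mod_cast hc
  have hden : aeval r N * u + aeval r M ≠ 0 :=
    h r (fun i => hw _) u (mul_nonneg hc' hτ.1) (by simpa [hu] using mul_le_mul_of_nonneg_left hτ.2 hc')
  have hupd : ∀ Y : ℝ, Fin.init (Function.update w (iYs m) Y) = Function.update r (Fin.last m) Y ∧
      Function.update w (iYs m) Y (Fin.last (m + 1)) = w (Fin.last (m + 1)) := by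
    intro Y
    constructor
    · funext j
      by_cases hj : j = Fin.last m
      · subst hj
        rw [Function.update_self]
        exact Function.update_self (iYs m) Y w
      · rw [Function.update_of_ne hj]
        show Function.update w (iYs m) Y (Fin.castSucc j) = w (Fin.castSucc j)
        rw [Function.update_of_ne (show Fin.castSucc j ≠ iYs m from fun h' => hj (Fin.castSucc_injective _ h'))]
    · rw [Function.update_of_ne]
      exact fun h' => by have := congrArg Fin.val h'; simp [iYs] at this
  have hfun : (fun Y : ℝ => (lastS c hc (Letter.reg N M) h).fn (Function.update w (iYs m) Y)) =
      fun Y => aeval (Function.update r (Fin.last m) Y) N / (aeval (Function.update r (Fin.last m) Y) N * u +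
        aeval (Function.update r (Fin.last m) Y) M) := by
    funext Y; rw [fn_lastS, (hupd Y).1, (hupd Y).2, Letter.lastR_reg]
  have h1 := (lastS c hc (Letter.reg N M) h).hasDerivAt_fn_update hw (iYs m)
  rw [hfun, show w (iYs m) = r (Fin.last m) from rfl] at h1
  have hN := hasDerivAt_aeval_snoc_last N r
  have hM := hasDerivAt_aeval_snoc_last M r
  have h2 := hN.div ((hN.mul_const u).add hM) (by simp only [Pi.add_apply, Function.update_eq_self]; exact hden)
  have hd := h1.unique h2
  simp only [Pi.add_apply, Function.update_eq_self] at hd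
  rw [hd]
  field_simp
  ring

/-! ### The `δZ`-bridge -/

/-- The word function of the empty word is `1`. [folklore] -/
theorem fn_Zw_nil (c : ℚ) (hc : 0 ≤ c) (d : ι → Letter m) (hd : ∀ a, (d a).IsRegular c)
    (z : Fin ((0 + m) + 1) → ℝ) : (Zw c hc d hd ([] : List ι)).fn z = 1 := by
  simp [Zw, RFun.fn]

/-- `∂_Y Z_{[]} = 0`. [folklore] -/
theorem fn_pdY_Zw_nil (c : ℚ) (hc : 0 ≤ c) (d : ι → Letter (m + 1)) (hd : ∀ a, (d a).IsRegular c)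
    {z : Fin ((0 + (m + 1)) + 1) → ℝ} (hz : z ∈ KZ.cube ((0 + (m + 1)) + 1)) :
    (pdY (Zw c hc d hd ([] : List ι))).fn z = 0 := by
  have h1 := (Zw c hc d hd ([] : List ι)).hasDerivAt_fn_update hz (iY 0 m)
  have : (fun t : ℝ => (Zw c hc d hd ([] : List ι)).fn (Function.update z (iY 0 m) t)) = fun _ => 1 := by
    funext t; exact fn_Zw_nil c hc d hd _
  rw [this] at h1
  exact h1.unique (hasDerivAt_const _ _)

/-- The head factor value of a substituted letter. [folklore] -/
theorem fn_headF_substY (c : ℚ) (hc : 0 ≤ c) (ℓ : Letter (m + 1)) (hℓ : ℓ.IsRegular c) (Υ : MvPolynomial (Fin (m + k)) ℚ)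
    (hΥ : IsScale Υ) (z : Fin ((n + (m + k)) + 1) → ℝ) :
    (headF (n := n) c hc (ℓ.substY Υ) (ℓ.isRegular_substY hΥ hℓ)).fn z = (headF (n := n) c hc ℓ hℓ).fn (yPt n Υ z) := by
  rw [fn_headF, fn_headF, wRider_yPt, wScale_yPt]
  cases ℓ with
  | inv => rfl
  | reg N M => simp only [Letter.substY, Letter.cR_reg, aeval_bind₁, aeval_riderSubstY]

/-- Evaluating the substituted rider polynomials at the riders of a layout point. [folklore] -/
theorem aeval_bind₁_riderSubstY (Υ : MvPolynomial (Fin (m + k)) ℚ) (P : MvPolynomial (Fin (m + 1)) ℚ) (e : Fin (m + k) → ℝ) :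
    aeval e (bind₁ (riderSubstY Υ) P) = aeval (Fin.snoc (fun j => e (Fin.castAdd k j)) (aeval e Υ) : Fin (m + 1) → ℝ) P := by
  rw [aeval_bind₁, aeval_riderSubstY]

/-- Evaluating transverse derivative data `Y ∂_Y P` after substitution. [folklore] -/
theorem aeval_deriv_substY (Υ : MvPolynomial (Fin (m + k)) ℚ) (P : MvPolynomial (Fin (m + 1)) ℚ) (e : Fin (m + k) → ℝ) :
    aeval e (bind₁ (riderSubstY Υ) (X (Fin.last m) * pderiv (Fin.last m) P)) =
      aeval e Υ * aeval (Fin.snoc (fun j => e (Fin.castAdd k j)) (aeval e Υ) : Fin (m + 1) → ℝ) (pderiv (Fin.last m) P) := by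
  rw [aeval_bind₁_riderSubstY, map_mul, aeval_X, Fin.snoc_last]

namespace DirData

variable (Δ₁ : DirData ι (m + 1)) (Υ : MvPolynomial (Fin (m + k)) ℚ) (hΥ : IsScale Υ)

/-- The transverse derivative of the head factor of a letter, tied: `Y (∂_Y c_a)` at `Y := Υ`,
equals the formal `δc_a` of the substituted data. [folklore] -/
theorem fn_headSD'_substY (hD : Δ₁.IsDeriv) (a : Option ι) {p : Fin ((n + (m + k)) + 1) → ℝ}
    (hp : p ∈ KZ.cube ((n + (m + k)) + 1)) :
    (yPt n Υ p) (iY n m) * ((headS Δ₁.c Δ₁.hc (Δ₁.d a) (Δ₁.hd a)).pd (iYs m)).fn (Fin.snoc (wRider (yPt n Υ p)) (wScale (yPt n Υ p))) =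
      ((Δ₁.substY Υ hΥ).headSD' a).fn (Fin.snoc (wRider p) (wScale p)) := by
  have hwY : (Fin.snoc (wRider (yPt n Υ p)) (wScale (yPt n Υ p)) : Fin ((m + 1) + 1) → ℝ) ∈ KZ.cube ((m + 1) + 1) :=
    KZ.snoc_mem_cube_iff.2 ⟨wRider_mem (yPt_mem hΥ hp), (yPt_mem (n := n) hΥ hp _).1, (yPt_mem (n := n) hΥ hp _).2⟩
  have hY : (yPt n Υ p) (iY n m) = aeval (wRider p) Υ := by
    have := congrFun (wRider_yPt (n := n) Υ p) (Fin.last m)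
    rw [Fin.snoc_last] at this
    exact this
  cases a with
  | none =>
    rw [headSD']
    simp only [Option.elim, RFun.fn_const, d_none]
    rw [fn_pd_headS_inv Δ₁.c Δ₁.hc (Δ₁.hd none) hwY, mul_zero]
    push_cast; rfl
  | some ℓ =>
    rw [headSD']
    simp only [Option.elim]
    show yPt n Υ p (iY n m) * ((headS Δ₁.c Δ₁.hc (Letter.reg (Δ₁.N ℓ) (Δ₁.M ℓ)) (Δ₁.reg ℓ)).pd (iYs m)).fn
      (Fin.snoc (wRider (yPt n Υ p)) (wScale (yPt n Υ p))) = _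
    have hden := (Δ₁.substY Υ hΥ).denr_ne ℓ (w := Fin.snoc (wRider p) (wScale p))
      (KZ.snoc_mem_cube_iff.2 ⟨wRider_mem hp, (hp _).1, (hp _).2⟩)
    rw [fn_pd_headS_reg Δ₁.c Δ₁.hc (Δ₁.N ℓ) (Δ₁.M ℓ) (Δ₁.reg ℓ) hwY, fn_headSD, hY]
    simp only [Nr, Mr, N'r, M'r, ur, substY, Fin.init_snoc, Fin.snoc_last, wRider_yPt, wScale_yPt,
      aeval_bind₁_riderSubstY, (hD ℓ).1, (hD ℓ).2, map_mul, aeval_X, Fin.snoc_last] at hden ⊢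
    set A1 := aeval (Fin.snoc (fun j => wRider p (Fin.castAdd k j)) (aeval (wRider p) Υ) : Fin (m + 1) → ℝ) (Δ₁.N ℓ)
    set A2 := aeval (Fin.snoc (fun j => wRider p (Fin.castAdd k j)) (aeval (wRider p) Υ) : Fin (m + 1) → ℝ) (Δ₁.M ℓ)
    set A3 := aeval (Fin.snoc (fun j => wRider p (Fin.castAdd k j)) (aeval (wRider p) Υ) : Fin (m + 1) → ℝ)
      (pderiv (Fin.last m) (Δ₁.N ℓ))
    set A4 := aeval (Fin.snoc (fun j => wRider p (Fin.castAdd k j)) (aeval (wRider p) Υ) : Fin (m + 1) → ℝ)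
      (pderiv (Fin.last m) (Δ₁.M ℓ))
    set yv := aeval (wRider p) Υ
    set u := (Δ₁.c : ℝ) * wScale p
    have hden2 : A1 * u + A2 ≠ 0 := hden
    field_simp

/-- The transverse derivative of the last factor, tied, equals the formal `δlast_a` of the substituted data. [folklore] -/
theorem fn_lastSD'_substY (hD : Δ₁.IsDeriv) (a : Option ι) {p : Fin ((n + (m + k)) + 1) → ℝ}
    (hp : p ∈ KZ.cube ((n + (m + k)) + 1)) :
    (yPt n Υ p) (iY n m) * ((lastS Δ₁.c Δ₁.hc (Δ₁.d a) (Δ₁.hd a)).pd (iYs m)).fn (Fin.snoc (wRider (yPt n Υ p)) (wScale (yPt n Υ p))) =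
      ((Δ₁.substY Υ hΥ).lastSD' a).fn (Fin.snoc (wRider p) (wScale p)) := by
  have hwY : (Fin.snoc (wRider (yPt n Υ p)) (wScale (yPt n Υ p)) : Fin ((m + 1) + 1) → ℝ) ∈ KZ.cube ((m + 1) + 1) :=
    KZ.snoc_mem_cube_iff.2 ⟨wRider_mem (yPt_mem hΥ hp), (yPt_mem (n := n) hΥ hp _).1, (yPt_mem (n := n) hΥ hp _).2⟩
  have hY : (yPt n Υ p) (iY n m) = aeval (wRider p) Υ := by
    have := congrFun (wRider_yPt (n := n) Υ p) (Fin.last m)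
    rw [Fin.snoc_last] at this
    exact this
  cases a with
  | none =>
    rw [lastSD']
    simp only [Option.elim, RFun.fn_const, d_none]
    rw [fn_pd_lastS_inv Δ₁.c Δ₁.hc (Δ₁.hd none) hwY, mul_zero]
    push_cast; rfl
  | some ℓ =>
    rw [lastSD']
    simp only [Option.elim]
    show yPt n Υ p (iY n m) * ((lastS Δ₁.c Δ₁.hc (Letter.reg (Δ₁.N ℓ) (Δ₁.M ℓ)) (Δ₁.reg ℓ)).pd (iYs m)).fn
      (Fin.snoc (wRider (yPt n Υ p)) (wScale (yPt n Υ p))) = _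
    have hden := (Δ₁.substY Υ hΥ).denr_ne ℓ (w := Fin.snoc (wRider p) (wScale p))
      (KZ.snoc_mem_cube_iff.2 ⟨wRider_mem hp, (hp _).1, (hp _).2⟩)
    rw [fn_pd_lastS_reg Δ₁.c Δ₁.hc (Δ₁.N ℓ) (Δ₁.M ℓ) (Δ₁.reg ℓ) hwY, fn_lastSD, hY]
    simp only [Nr, Mr, N'r, M'r, ur, substY, Fin.init_snoc, Fin.snoc_last, wRider_yPt, wScale_yPt,
      aeval_bind₁_riderSubstY, (hD ℓ).1, (hD ℓ).2, map_mul, aeval_X, Fin.snoc_last] at hden ⊢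
    set A1 := aeval (Fin.snoc (fun j => wRider p (Fin.castAdd k j)) (aeval (wRider p) Υ) : Fin (m + 1) → ℝ) (Δ₁.N ℓ)
    set A2 := aeval (Fin.snoc (fun j => wRider p (Fin.castAdd k j)) (aeval (wRider p) Υ) : Fin (m + 1) → ℝ) (Δ₁.M ℓ)
    set A3 := aeval (Fin.snoc (fun j => wRider p (Fin.castAdd k j)) (aeval (wRider p) Υ) : Fin (m + 1) → ℝ)
      (pderiv (Fin.last m) (Δ₁.N ℓ))
    set A4 := aeval (Fin.snoc (fun j => wRider p (Fin.castAdd k j)) (aeval (wRider p) Υ) : Fin (m + 1) → ℝ)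
      (pderiv (Fin.last m) (Δ₁.M ℓ))
    set yv := aeval (wRider p) Υ
    set u := (Δ₁.c : ℝ) * wScale p
    have hden2 : A1 * u + A2 ≠ 0 := hden
    field_simp

/-- **The `δZ`-bridge**: the tied transverse derivative `Y ∂_Y Z_w` at `Y := Υ` is the formal
transverse derivative `δZ_w` of the substituted data. [folklore] -/
theorem fn_famY_YZw (hD : Δ₁.IsDeriv) :
    ∀ (w : List (Option ι)) (z : Fin ((w.length + (m + k)) + 1) → ℝ), z ∈ KZ.cube ((w.length + (m + k)) + 1) →
      (famY (smulY (pdY (Zw Δ₁.c Δ₁.hc Δ₁.d Δ₁.hd w))) Υ hΥ).fn z = ((Δ₁.substY Υ hΥ).ZD w).fn z := by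
  intro w
  induction w with
  | nil =>
    intro z hz
    simp only [List.length_nil] at hz ⊢
    rw [fn_famY, fn_smulY, fn_pdY_Zw_nil _ _ _ _ (yPt_mem hΥ hz), mul_zero, DirData.ZD, RFun.fn_const]
    push_cast; rfl
  | cons a w ih =>
    intro z hz
    simp only [List.length_cons] at hz ⊢
    have hpeel : ∀ z' ∈ KZ.cube (((w.length + 1) + (m + 1)) + 1),
        (Zw Δ₁.c Δ₁.hc Δ₁.d Δ₁.hd (a :: w)).fn z' = (peelF Δ₁.c Δ₁.hc Δ₁.d Δ₁.hd a w).fn (peelPt z') :=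
      fun z' hz' => fn_Zw_eq_peelF _ _ _ _ a w z' hz'
    have hyz := yPt_mem (n := w.length + 1) hΥ hz
    rw [fn_famY, fn_smulY, fn_pdY_of_peel _ _ hpeel hyz, fn_ZD_cons, peelPt_yPt]
    -- the `Y`-coordinate is unchanged by peeling
    have hYeq : yPt (w.length + 1) Υ z (iY (w.length + 1) m) = yPt w.length Υ (peelPt z) (iY w.length m) := by
      have h1 := congrFun (wRider_yPt (n := w.length + 1) Υ z) (Fin.last m)
      have h2 := congrFun (wRider_yPt (n := w.length) Υ (peelPt z)) (Fin.last m)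
      rw [Fin.snoc_last] at h1 h2
      rw [wRider_peelPt] at h2
      exact h1.trans h2.symm
    rw [hYeq]
    have hpz : peelPt z ∈ KZ.cube ((w.length + (m + k)) + 1) := peelPt_mem hz
    have hyp : yPt w.length Υ (peelPt z) ∈ KZ.cube ((w.length + (m + 1)) + 1) := yPt_mem hΥ hpz
    by_cases hw : w = []
    · subst hw
      rw [peelF, if_pos rfl, DirData.peelFD, if_pos rfl, fn_liftS,
        fn_pdY_of_scaleOnly (lastS _ _ _ _) (lastF _ _ _ _) (fn_lastF_eq _ _ _ _) hyp]
      exact Δ₁.fn_lastSD'_substY Υ hΥ hD a hpz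
    · have I1 : yPt w.length Υ (peelPt z) (iY w.length m) * (pdY (headF Δ₁.c Δ₁.hc (Δ₁.d a) (Δ₁.hd a))).fn (yPt w.length Υ (peelPt z)) =
          ((Δ₁.substY Υ hΥ).headSD' a).fn (Fin.snoc (wRider (peelPt z)) (wScale (peelPt z))) := by
        rw [fn_pdY_of_scaleOnly (headS _ _ _ _) (headF _ _ _ _) (fn_headF_eq _ _ _ _) hyp]
        exact Δ₁.fn_headSD'_substY Υ hΥ hD a hpz
      have I2 : (Zw Δ₁.c Δ₁.hc Δ₁.d Δ₁.hd w).fn (yPt w.length Υ (peelPt z)) =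
          (Zw (Δ₁.substY Υ hΥ).c (Δ₁.substY Υ hΥ).hc (Δ₁.substY Υ hΥ).d (Δ₁.substY Υ hΥ).hd w).fn (peelPt z) := by
        rw [← fn_famY _ _ hΥ, fn_famY_Zw_substY Δ₁ Υ hΥ w hpz]
      have I3 : (headF Δ₁.c Δ₁.hc (Δ₁.d a) (Δ₁.hd a)).fn (yPt w.length Υ (peelPt z)) =
          (headF (Δ₁.substY Υ hΥ).c (Δ₁.substY Υ hΥ).hc ((Δ₁.substY Υ hΥ).d a) ((Δ₁.substY Υ hΥ).hd a)).fn (peelPt z) := by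
        rw [fn_headF, fn_headF, wRider_yPt, wScale_yPt]
        cases a with
        | none => rfl
        | some ℓ => simp only [DirData.d_some, DirData.substY, Letter.cR_reg, aeval_bind₁_riderSubstY]
      have I4 : yPt w.length Υ (peelPt z) (iY w.length m) * (pdY (Zw Δ₁.c Δ₁.hc Δ₁.d Δ₁.hd w)).fn (yPt w.length Υ (peelPt z)) =
          ((Δ₁.substY Υ hΥ).ZD w).fn (peelPt z) := by
        rw [← fn_smulY, ← fn_famY _ _ hΥ, ih _ hpz]
      rw [peelF, if_neg hw, DirData.peelFD, if_neg hw, pdY, RFun.fn_pd_mul _ _ hyp, ← pdY, ← pdY, RFun.fn_add hpz,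
        RFun.fn_mul, RFun.fn_mul, fn_liftS, mul_add, ← mul_assoc, I1, I2, mul_left_comm, I4, I3]

end DirData

end SubstY


/-! ## The diagonal (S) at the level of the regularised series of substituted data -/

section DiagZS

open Shuffle NCSeries

variable {R : Type} [CommRing R] [Algebra ℚ R] {χ : KZ.FormalRep →+ R} (hrel : ∀ c ∈ KZ.relations, χ c = 0)
variable {ι : Type} [Fintype ι] [DecidableEq ι] {m n k : ℕ}
variable {A : Type} [Ring A] [Algebra R A]

/-- Updating the scale commutes with `yPt`. [folklore] -/
theorem yPt_update_last (Υ : MvPolynomial (Fin (m + k)) ℚ) (z : Fin ((n + (m + k)) + 1) → ℝ) (t : ℝ) :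
    yPt n Υ (Function.update z (Fin.last _) t) = Function.update (yPt n Υ z) (Fin.last _) t := by
  have hX : wX (Function.update z (Fin.last (n + (m + k))) t) = wX z := by
    funext j; simp only [wX]; rw [Function.update_of_ne (Fin.castSucc_lt_last _).ne]
  have hR : wRider (Function.update z (Fin.last (n + (m + k))) t) = wRider z := by
    funext j; simp only [wRider]; rw [Function.update_of_ne (Fin.castSucc_lt_last _).ne]
  apply layout_ext
  · rw [wX_yPt, hX, ← wX_yPt (n := n) Υ z]
    funext j; simp only [wX]; rw [Function.update_of_ne (Fin.castSucc_lt_last _).ne]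
  · rw [wRider_yPt, hR, ← wRider_yPt]
    funext j; simp only [wRider]; rw [Function.update_of_ne (Fin.castSucc_lt_last _).ne]
  · rw [wScale_yPt]
    simp only [wScale, Function.update_self]

/-- The scale derivative of the tied function is the tied scale derivative (pointwise). [folklore] -/
theorem fn_famY_scaleDeriv (T : RFun ((n + (m + 1)) + 1)) (Υ : MvPolynomial (Fin (m + k)) ℚ) (hΥ : IsScale Υ)
    {z : Fin ((n + (m + k)) + 1) → ℝ} (hz : z ∈ KZ.cube ((n + (m + k)) + 1)) :
    (famY (scaleDeriv T) Υ hΥ).fn z = (scaleDeriv (famY T Υ hΥ)).fn z := by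
  have hyz := yPt_mem (n := n) hΥ hz
  have hsplit : z = Fin.snoc (Fin.init z) (z (Fin.last _)) := (Fin.snoc_init_self z).symm
  have hsplitY : yPt n Υ z = Fin.snoc (Fin.init (yPt n Υ z)) (z (Fin.last _)) := by
    conv_lhs => rw [← Fin.snoc_init_self (yPt n Υ z)]
    rw [show yPt n Υ z (Fin.last _) = z (Fin.last _) from wScale_yPt (n := n) Υ z]
  have hp : Fin.init z ∈ KZ.cube (n + (m + k)) := fun i => hz _
  have hpY : Fin.init (yPt n Υ z) ∈ KZ.cube (n + (m + 1)) := fun i => hyz _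
  have ht : z (Fin.last _) ∈ Icc (0 : ℝ) 1 := ⟨(hz _).1, (hz _).2⟩
  -- the last-coordinate derivatives agree
  have hd : (famY T Υ hΥ).dlast.fn z = T.dlast.fn (yPt n Υ z) := by
    rw [← RFun.pd_last, ← RFun.pd_last]
    refine RFun.fn_pd_eq_of_eqOn _ _ hz hyz _ _ (wScale_yPt (n := n) Υ z).symm fun t _ => ?_
    rw [fn_famY, yPt_update_last]
  rw [fn_famY]
  conv_lhs => rw [hsplitY, fn_scaleDeriv T hpY ht, ← hsplitY]
  conv_rhs => rw [hsplit, fn_scaleDeriv (famY T Υ hΥ) hp ht, ← hsplit]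
  rw [fn_famY, hd]

/-- The scale derivative only depends on the values on the cube. [folklore] -/
theorem fn_scaleDeriv_congr {F G : RFun ((n + m) + 1)} (h : ∀ z ∈ KZ.cube ((n + m) + 1), F.fn z = G.fn z)
    {z : Fin ((n + m) + 1) → ℝ} (hz : z ∈ KZ.cube ((n + m) + 1)) : (scaleDeriv F).fn z = (scaleDeriv G).fn z := by
  have hsplit : z = Fin.snoc (Fin.init z) (z (Fin.last _)) := (Fin.snoc_init_self z).symm
  have hp : Fin.init z ∈ KZ.cube (n + m) := fun i => hz _
  have ht : z (Fin.last _) ∈ Icc (0 : ℝ) 1 := ⟨(hz _).1, (hz _).2⟩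
  have hd : F.dlast.fn z = G.dlast.fn z := by
    rw [← RFun.pd_last, ← RFun.pd_last]
    exact RFun.fn_pd_eq_of_eqOn _ _ hz hz _ _ rfl fun t ht' => h _ (KZ.update_mem_cube hz _ ht'.1 ht'.2)
  rw [hsplit, fn_scaleDeriv F hp ht, fn_scaleDeriv G hp ht, ← hsplit, h z hz, hd]

namespace DirData

variable (Δ₁ : DirData ι (m + 1))

include hrel

omit [Algebra ℚ R] [Fintype ι] [DecidableEq ι] in
/-- **The diagonal (S), word by word**: for substituted data,
`zcoef_{Δ∘π}(ρ, π) = dcoef_{Δ∘π⁺}(ρ⁺, π⁺) + ycoef_{Δ∘π⁺}(ρ⁺, π⁺)`. [folklore] -/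
theorem zcoef_substY_diag_S (hD : Δ₁.IsDeriv) (ρ : RFun (m + k)) (π : MvPolynomial (Fin (m + k)) ℚ) (hπ : IsScale π)
    (v : List (Option ι)) :
    zcoef (χ := χ) (m := m + k) (k := 0) (Δ₁.substY π hπ).c (Δ₁.substY π hπ).hc (Δ₁.substY π hπ).d (Δ₁.substY π hπ).hd ρ π hπ v =
      dcoef (χ := χ) (m := m + (k + 1)) (k := 0) (Δ₁.substY (k := k + 1) (scaleMul π) (isScale_scaleMul hπ)).c
          (Δ₁.substY (k := k + 1) (scaleMul π) (isScale_scaleMul hπ)).hc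
          (Δ₁.substY (k := k + 1) (scaleMul π) (isScale_scaleMul hπ)).d
          (Δ₁.substY (k := k + 1) (scaleMul π) (isScale_scaleMul hπ)).hd ρ.lift (scaleMul π) (isScale_scaleMul hπ) v +
        (Δ₁.substY (k := k + 1) (scaleMul π) (isScale_scaleMul hπ)).ycoef (χ := χ) (k := 0) ρ.lift (scaleMul π)
          (isScale_scaleMul hπ) v := by
  have hπ' := isScale_scaleMul hπ
  have h1 : zcoef (χ := χ) (m := m + k) (k := 0) (Δ₁.substY π hπ).c (Δ₁.substY π hπ).hc (Δ₁.substY π hπ).d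
      (Δ₁.substY π hπ).hd ρ π hπ v = (famTerm (m := m + k) (k := 0) ρ (famY (Zw Δ₁.c Δ₁.hc Δ₁.d Δ₁.hd v) π hπ) π hπ).chi χ :=
    RFun.chi_congr hrel fun y hy => by
      rw [fn_famTerm, fn_famTerm, fn_famY_Zw_substY Δ₁ π hπ v (famPt_mem (m := m + k) (k := 0) hπ hy)]
  rw [h1, chi_famTerm_famY_diag hrel ρ _ π hπ]
  refine congrArg₂ (· + ·) ?_ ?_
  · refine RFun.chi_congr hrel fun y hy => ?_
    rw [fn_famTerm, fn_famTerm]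
    have hz := famPt_mem (n := v.length) (m := m + (k + 1)) (k := 0) hπ' hy
    rw [fn_famY_scaleDeriv _ _ hπ' hz,
      fn_scaleDeriv_congr (F := famY (Zw Δ₁.c Δ₁.hc Δ₁.d Δ₁.hd v) (scaleMul π) hπ') (fun z hz' => fn_famY_Zw_substY Δ₁ (scaleMul π) hπ' v hz') hz]
  · refine RFun.chi_congr hrel fun y hy => ?_
    rw [fn_famTerm, fn_famTerm, Δ₁.fn_famY_YZw (scaleMul π) hπ' hD v _ (famPt_mem (m := m + (k + 1)) (k := 0) hπ' hy)]

/-- **The diagonal (S) at residues**: `ZS_j[Δ∘π](ρ,π) = DS_j[Δ∘π⁺](ρ⁺,π⁺) + YS_j[Δ∘π⁺](ρ⁺,π⁺)`. [folklore] -/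
theorem ZS_substY_diag_S (hD : Δ₁.IsDeriv) (j : ℕ) (t : Option ι → A) (ρ : RFun (m + k)) (π : MvPolynomial (Fin (m + k)) ℚ)
    (hπ : IsScale π) :
    ZS (χ := χ) (m := m + k) (k := 0) (Δ₁.substY π hπ).c (Δ₁.substY π hπ).hc (Δ₁.substY π hπ).d (Δ₁.substY π hπ).hd j t none ρ π hπ =
      DS (χ := χ) (m := m + (k + 1)) (k := 0) (Δ₁.substY (k := k + 1) (scaleMul π) (isScale_scaleMul hπ)).c
          (Δ₁.substY (k := k + 1) (scaleMul π) (isScale_scaleMul hπ)).hc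
          (Δ₁.substY (k := k + 1) (scaleMul π) (isScale_scaleMul hπ)).d
          (Δ₁.substY (k := k + 1) (scaleMul π) (isScale_scaleMul hπ)).hd j t none ρ.lift (scaleMul π) (isScale_scaleMul hπ) +
        (Δ₁.substY (k := k + 1) (scaleMul π) (isScale_scaleMul hπ)).YS (χ := χ) (k := 0) j t ρ.lift (scaleMul π)
          (isScale_scaleMul hπ) := by
  unfold ZS DS YS
  rw [← evalW_add]
  congr 1
  funext W
  simp only [Zser, Dser, Yser, NCSeries.add_apply]
  split_ifs
  · simp
  · rw [← pair_add_fun']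
    exact pair_congr fun v _ => Δ₁.zcoef_substY_diag_S hrel hD ρ π hπ v

end DirData

end DiagZS


/-! ## Joint families: tied form, transverse derivative, diagonal (S) word by word -/

section JointDiag

open Shuffle NCSeries

variable {R : Type} [CommRing R] [Algebra ℚ R] {χ : KZ.FormalRep →+ R} (hrel : ∀ c ∈ KZ.relations, χ c = 0)
variable {ι : Type} [Fintype ι] [DecidableEq ι] {m n₁ n₂ k : ℕ}
variable {A : Type} [Ring A] [Algebra R A]

/-- `yPt` commutes with the block projections. [folklore] -/
theorem projB_yPt (Υ : MvPolynomial (Fin (m + k)) ℚ) (z : Fin (((n₁ + n₂) + (m + k)) + 1) → ℝ) :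
    projB₁ (yPt (n₁ + n₂) Υ z) = yPt n₁ Υ (projB₁ z) ∧ projB₂ (yPt (n₁ + n₂) Υ z) = yPt n₂ Υ (projB₂ z) := by
  constructor
  · apply layout_ext
    · funext j; rw [wX_projB₁, wX_yPt, wX_yPt, wX_projB₁]
    · rw [wRider_projB₁, wRider_yPt, wRider_yPt, wRider_projB₁]
    · rw [wScale_projB₁, wScale_yPt, wScale_yPt, wScale_projB₁]
  · apply layout_ext
    · funext j; rw [wX_projB₂, wX_yPt, wX_yPt, wX_projB₂]
    · rw [wRider_projB₂, wRider_yPt, wRider_yPt, wRider_projB₂]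
    · rw [wScale_projB₂, wScale_yPt, wScale_yPt, wScale_projB₂]

/-- The tied `τ`-weighted joint function is the `τ`-weighted joint of the tied blocks (pointwise). [folklore] -/
theorem fn_famY_X_boxT (T₁ : RFun ((n₁ + (m + 1)) + 1)) (T₂ : RFun ((n₂ + (m + 1)) + 1)) (Υ : MvPolynomial (Fin (m + k)) ℚ)
    (hΥ : IsScale Υ) (z : Fin (((n₁ + n₂) + (m + k)) + 1) → ℝ) :
    (famY ((RFun.poly (X (Fin.last _))).mul (boxT T₁ T₂)) Υ hΥ).fn z =
      ((RFun.poly (X (Fin.last _))).mul (boxT (famY T₁ Υ hΥ) (famY T₂ Υ hΥ))).fn z := by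
  rw [fn_famY, RFun.fn_mul, RFun.fn_poly, aeval_X, fn_boxT, RFun.fn_mul, RFun.fn_poly, aeval_X, fn_boxT, fn_famY, fn_famY,
    (projB_yPt Υ z).1, (projB_yPt Υ z).2]
  congr 1
  exact wScale_yPt (n := n₁ + n₂) Υ z

/-- Updating `Y` commutes with the block projections. [folklore] -/
theorem projB_update_iY (z : Fin (((n₁ + n₂) + (m + 1)) + 1) → ℝ) (t : ℝ) :
    projB₁ (Function.update z (iY (n₁ + n₂) m) t) = Function.update (projB₁ z) (iY n₁ m) t ∧
    projB₂ (Function.update z (iY (n₁ + n₂) m) t) = Function.update (projB₂ z) (iY n₂ m) t := by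
  constructor
  · apply layout_ext
    · funext j; rw [wX_projB₁, wX_update_iY, wX_update_iY, wX_projB₁]
    · rw [wRider_projB₁, wRider_update_iY, wRider_update_iY, wRider_projB₁]
    · rw [wScale_projB₁, wScale_update_iY, wScale_update_iY, wScale_projB₁]
  · apply layout_ext
    · funext j; rw [wX_projB₂, wX_update_iY, wX_update_iY, wX_projB₂]
    · rw [wRider_projB₂, wRider_update_iY, wRider_update_iY, wRider_projB₂]
    · rw [wScale_projB₂, wScale_update_iY, wScale_update_iY, wScale_projB₂]

/-- The `Y`-coordinate of the block points. [folklore] -/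
theorem projB_iY (z : Fin (((n₁ + n₂) + (m + 1)) + 1) → ℝ) :
    projB₁ z (iY n₁ m) = z (iY (n₁ + n₂) m) ∧ projB₂ z (iY n₂ m) = z (iY (n₁ + n₂) m) := by
  have h1 := congrFun (wRider_projB₁ (n₁ := n₁) (n₂ := n₂) z) (Fin.last m)
  have h2 := congrFun (wRider_projB₂ (n₁ := n₁) (n₂ := n₂) z) (Fin.last m)
  exact ⟨h1, h2⟩

/-- **Product rule for the transverse derivative of a joint function** (both blocks read the same `Y`). [folklore] -/
theorem fn_pdY_boxT (T₁ : RFun ((n₁ + (m + 1)) + 1)) (T₂ : RFun ((n₂ + (m + 1)) + 1))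
    {z : Fin (((n₁ + n₂) + (m + 1)) + 1) → ℝ} (hz : z ∈ KZ.cube (((n₁ + n₂) + (m + 1)) + 1)) :
    (pdY (boxT T₁ T₂)).fn z = (pdY T₁).fn (projB₁ z) * T₂.fn (projB₂ z) + T₁.fn (projB₁ z) * (pdY T₂).fn (projB₂ z) := by
  have hz12 := projB_mem hz
  -- transfer the partial derivatives of the two factors
  have h1 : ((T₁.subst (subB₁ n₁ n₂ (m + 1)) fun z hz => by rw [aeval_subB₁]; exact (projB_mem hz).1).pd (iY (n₁ + n₂) m)).fn z =
      (pdY T₁).fn (projB₁ z) :=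
    RFun.fn_pd_eq_of_eqOn _ _ hz hz12.1 _ _ (projB_iY z).1.symm fun t _ => by
      rw [RFun.fn_subst, aeval_subB₁, (projB_update_iY z t).1]
  have h2 : ((T₂.subst (subB₂ n₁ n₂ (m + 1)) fun z hz => by rw [aeval_subB₂]; exact (projB_mem hz).2).pd (iY (n₁ + n₂) m)).fn z =
      (pdY T₂).fn (projB₂ z) :=
    RFun.fn_pd_eq_of_eqOn _ _ hz hz12.2 _ _ (projB_iY z).2.symm fun t _ => by
      rw [RFun.fn_subst, aeval_subB₂, (projB_update_iY z t).2]
  rw [pdY, boxT, RFun.fn_pd_mul _ _ hz, h1, h2, RFun.fn_subst, RFun.fn_subst, aeval_subB₁, aeval_subB₂]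

/-- `Y`-multiplication passes to either block. [folklore] -/
theorem fn_smulY_boxT (S₁ : RFun ((n₁ + (m + 1)) + 1)) (T₂ : RFun ((n₂ + (m + 1)) + 1))
    (z : Fin (((n₁ + n₂) + (m + 1)) + 1) → ℝ) :
    (smulY (boxT S₁ T₂)).fn z = (boxT (smulY S₁) T₂).fn z ∧ (smulY (boxT S₁ T₂)).fn z = (boxT S₁ (smulY T₂)).fn z := by
  rw [fn_smulY, fn_boxT, fn_boxT, fn_boxT, fn_smulY, fn_smulY, (projB_iY z).1, (projB_iY z).2]
  constructor <;> ring

/-- The transverse derivative of a `τ`-weighted function. [folklore] -/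
theorem fn_pdY_X_mul (B : RFun (((n₁ + n₂) + (m + 1)) + 1)) {z : Fin (((n₁ + n₂) + (m + 1)) + 1) → ℝ}
    (hz : z ∈ KZ.cube (((n₁ + n₂) + (m + 1)) + 1)) :
    (pdY ((RFun.poly (X (Fin.last _))).mul B)).fn z = z (Fin.last _) * (pdY B).fn z := by
  have h0 : pderiv (iY (n₁ + n₂) m) (X (Fin.last ((n₁ + n₂) + (m + 1))) : MvPolynomial (Fin (((n₁ + n₂) + (m + 1)) + 1)) ℚ) = 0 := by
    rw [pderiv_X]
    have hne : (Fin.last ((n₁ + n₂) + (m + 1)) : Fin (((n₁ + n₂) + (m + 1)) + 1)) ≠ iY (n₁ + n₂) m := by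
      intro h; have := congrArg Fin.val h; simp [iY] at this
    simp [hne]
  rw [pdY, RFun.fn_pd_mul _ _ hz, RFun.fn_pd_poly, RFun.fn_poly, aeval_X, h0, map_zero, zero_mul, zero_add]
  rfl

include hrel

omit [Algebra ℚ R] [Fintype ι] [DecidableEq ι] in
/-- **The diagonal (S) for a `τ`-weighted joint of tied blocks, word function by word function**:
`⟪ρ (τ T₁T₂)[Y:=π][π]⟫ = ⟪ρ⁺ (τ (∂_τ(τT₁) T₂ + (Y∂_YT₁) T₂ + T₁ ∂_τ(τT₂) + T₁ (Y∂_YT₂)))[Y:=π⁺][π⁺]⟫`. [folklore] -/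
theorem chi_famTerm_X_boxT_diag (ρ : RFun (m + k)) (T₁ : RFun ((n₁ + (m + 1)) + 1)) (T₂ : RFun ((n₂ + (m + 1)) + 1))
    (π : MvPolynomial (Fin (m + k)) ℚ) (hπ : IsScale π) :
    (famTerm (m := m + k) (k := 0) ρ (famY ((RFun.poly (X (Fin.last _))).mul (boxT T₁ T₂)) π hπ) π hπ).chi χ =
      (famTerm (m := m + (k + 1)) (k := 0) ρ.lift
          (famY (k := k + 1) ((RFun.poly (X (Fin.last _))).mul (boxT (scaleDeriv T₁) T₂)) (scaleMul π) (isScale_scaleMul hπ))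
          (scaleMul π) (isScale_scaleMul hπ)).chi χ +
      (famTerm (m := m + (k + 1)) (k := 0) ρ.lift
          (famY (k := k + 1) ((RFun.poly (X (Fin.last _))).mul (boxT (smulY (pdY T₁)) T₂)) (scaleMul π) (isScale_scaleMul hπ))
          (scaleMul π) (isScale_scaleMul hπ)).chi χ +
      (famTerm (m := m + (k + 1)) (k := 0) ρ.lift
          (famY (k := k + 1) ((RFun.poly (X (Fin.last _))).mul (boxT T₁ (scaleDeriv T₂))) (scaleMul π) (isScale_scaleMul hπ))
          (scaleMul π) (isScale_scaleMul hπ)).chi χ +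
      (famTerm (m := m + (k + 1)) (k := 0) ρ.lift
          (famY (k := k + 1) ((RFun.poly (X (Fin.last _))).mul (boxT T₁ (smulY (pdY T₂)))) (scaleMul π) (isScale_scaleMul hπ))
          (scaleMul π) (isScale_scaleMul hπ)).chi χ := by
  have hπ' := isScale_scaleMul hπ
  -- pointwise values of the derived joint functions
  have key : ∀ y ∈ KZ.cube ((n₁ + n₂) + ((m + (k + 1)) + 0)),
      let q := yPt (n₁ + n₂) (scaleMul π) (famPt (n₁ + n₂) (m := m + (k + 1)) (k := 0) (scaleMul π) y)
      (scaleDeriv ((RFun.poly (X (Fin.last _))).mul (boxT T₁ T₂))).fn q =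
        ((RFun.poly (X (Fin.last _))).mul (boxT (scaleDeriv T₁) T₂)).fn q +
          ((RFun.poly (X (Fin.last _))).mul (boxT T₁ (scaleDeriv T₂))).fn q ∧
      (smulY (pdY ((RFun.poly (X (Fin.last _))).mul (boxT T₁ T₂)))).fn q =
        ((RFun.poly (X (Fin.last _))).mul (boxT (smulY (pdY T₁)) T₂)).fn q +
          ((RFun.poly (X (Fin.last _))).mul (boxT T₁ (smulY (pdY T₂)))).fn q := by
    intro y hy q
    have hz := famPt_mem (n := n₁ + n₂) (m := m + (k + 1)) (k := 0) hπ' hy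
    have hyz : q ∈ KZ.cube (((n₁ + n₂) + (m + 1)) + 1) := yPt_mem (n := n₁ + n₂) hπ' hz
    have hsplit : q = Fin.snoc (Fin.init q) (q (Fin.last _)) := (Fin.snoc_init_self q).symm
    have hp : Fin.init q ∈ KZ.cube ((n₁ + n₂) + (m + 1)) := fun i => hyz _
    have ht : q (Fin.last _) ∈ Icc (0 : ℝ) 1 := ⟨(hyz _).1, (hyz _).2⟩
    constructor
    · conv_lhs => rw [hsplit, fn_scaleDeriv_X_boxT T₁ T₂ hp ht, ← hsplit]
      rw [RFun.fn_mul, RFun.fn_mul, RFun.fn_poly, aeval_X, mul_add]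
    · rw [fn_smulY, fn_pdY_X_mul _ hyz, fn_pdY_boxT T₁ T₂ hyz, RFun.fn_mul, RFun.fn_mul, RFun.fn_poly, aeval_X,
        fn_boxT, fn_boxT, fn_smulY, fn_smulY, (projB_iY q).1, (projB_iY q).2]
      ring
  rw [chi_famTerm_famY_diag hrel ρ _ π hπ]
  have hA : (famTerm (m := m + (k + 1)) (k := 0) ρ.lift
      (famY (k := k + 1) (scaleDeriv ((RFun.poly (X (Fin.last _))).mul (boxT T₁ T₂))) (scaleMul π) hπ') (scaleMul π) hπ').chi χ =
      (famTerm (m := m + (k + 1)) (k := 0) ρ.lift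
          (famY (k := k + 1) ((RFun.poly (X (Fin.last _))).mul (boxT (scaleDeriv T₁) T₂)) (scaleMul π) hπ') (scaleMul π) hπ').chi χ +
      (famTerm (m := m + (k + 1)) (k := 0) ρ.lift
          (famY (k := k + 1) ((RFun.poly (X (Fin.last _))).mul (boxT T₁ (scaleDeriv T₂))) (scaleMul π) hπ') (scaleMul π) hπ').chi χ := by
    rw [← RFun.chi_add hrel]
    refine RFun.chi_congr hrel fun y hy => ?_
    rw [RFun.fn_add hy, fn_famTerm, fn_famTerm, fn_famTerm, fn_famY, fn_famY, fn_famY, (key y hy).1]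
    ring
  have hB : (famTerm (m := m + (k + 1)) (k := 0) ρ.lift
      (famY (k := k + 1) (smulY (pdY ((RFun.poly (X (Fin.last _))).mul (boxT T₁ T₂)))) (scaleMul π) hπ') (scaleMul π) hπ').chi χ =
      (famTerm (m := m + (k + 1)) (k := 0) ρ.lift
          (famY (k := k + 1) ((RFun.poly (X (Fin.last _))).mul (boxT (smulY (pdY T₁)) T₂)) (scaleMul π) hπ') (scaleMul π) hπ').chi χ +
      (famTerm (m := m + (k + 1)) (k := 0) ρ.lift
          (famY (k := k + 1) ((RFun.poly (X (Fin.last _))).mul (boxT T₁ (smulY (pdY T₂)))) (scaleMul π) hπ') (scaleMul π) hπ').chi χ := by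
    rw [← RFun.chi_add hrel]
    refine RFun.chi_congr hrel fun y hy => ?_
    rw [RFun.fn_add hy, fn_famTerm, fn_famTerm, fn_famTerm, fn_famY, fn_famY, fn_famY, (key y hy).2]
    ring
  rw [hA, hB]
  abel

end JointDiag


/-! ## Joint functionals at residues: honest double sums and the two absorbed forms -/

section JointSeries

open Shuffle NCSeries

variable {R : Type} [CommRing R] [Algebra ℚ R] {χ : KZ.FormalRep →+ R} (hrel : ∀ c ∈ KZ.relations, χ c = 0)
variable {ι : Type} [Fintype ι] [DecidableEq ι] {M : ℕ}
variable {A : Type} [Ring A] [Algebra R A] [Module ℚ A] [IsScalarTower ℚ R A]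

/-- The residue product of a tuple of letters. [folklore] -/
def tprod (t : Option ι → A) {i : ℕ} (g : Fin i → Option ι) : A := ((List.ofFn g).map t).prod

/-- **The honest double functional** `Σ_{f,g} ⟨⟨c(u,v), regEnd g⟩_v, regEnd f⟩_u · t₁^f t₂^g`. [folklore] -/
def HH (i i' : ℕ) (t₁ t₂ : Option ι → A) (c : List (Option ι) → List (Option ι) → R) : A :=
  ∑ f : Fin i → Option ι, ∑ g : Fin i' → Option ι,
    pair (fun u => pair (fun v => c u v • (tprod t₁ f * tprod t₂ g)) (regEnd none (List.ofFn g))) (regEnd none (List.ofFn f))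

/-- Joint sum with the active slot FIRST: `Σ_g ⟨F(v) · t₂^g, regEnd g⟩_v`. [folklore] -/
def Jsum (i' : ℕ) (t₂ : Option ι → A) (F : List (Option ι) → A) : A :=
  ∑ g : Fin i' → Option ι, pair (fun v => F v * tprod t₂ g) (regEnd none (List.ofFn g))

/-- Joint sum with the active slot LAST: `Σ_f ⟨t₁^f · G(u), regEnd f⟩_u`. [folklore] -/
def Jsum' (i : ℕ) (t₁ : Option ι → A) (G : List (Option ι) → A) : A :=
  ∑ f : Fin i → Option ι, pair (fun u => tprod t₁ f * G u) (regEnd none (List.ofFn f))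

omit [Algebra ℚ R] [Fintype ι] [DecidableEq ι] in
/-- `pair` of a pointwise scalar multiple. [folklore] -/
theorem pair_smul_fun {K : Type*} [AddCommMonoid K] [Module ℚ K] [Module R K] [SMulCommClass ℚ R K] (r : R) (g : List (Option ι) → K)
    (F : List (Option ι) →₀ ℚ) : pair (fun v => r • g v) F = r • pair g F := by
  simp only [pair, Finsupp.sum, Finset.smul_sum]
  exact Finset.sum_congr rfl fun x _ => smul_comm _ _ _

omit [Fintype ι] [DecidableEq ι] in
/-- `pair` of a pointwise left multiple. [folklore] -/
theorem pair_mul_left (a : A) (g : List (Option ι) → A) (F : List (Option ι) →₀ ℚ) :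
    pair (fun v => a * g v) F = a * pair g F := by
  simp only [pair, Finsupp.sum, Finset.mul_sum, mul_smul_comm]

omit [Fintype ι] [DecidableEq ι] in
/-- `pair` of a pointwise right multiple. [folklore] -/
theorem pair_mul_right (a : A) (g : List (Option ι) → A) (F : List (Option ι) →₀ ℚ) :
    pair (fun v => g v * a) F = pair g F * a := by
  simp only [pair, Finsupp.sum, Finset.sum_mul, smul_mul_assoc]

omit [Fintype ι] [DecidableEq ι] in
/-- `pair` of a pointwise finite sum. [folklore] -/
theorem pair_finset_sum_fun {κ : Type*} (s : Finset κ) (g : κ → List (Option ι) → A) (F : List (Option ι) →₀ ℚ) :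
    pair (fun v => ∑ x ∈ s, g x v) F = ∑ x ∈ s, pair (g x) F := by
  simp only [pair, Finsupp.sum, Finset.smul_sum]
  rw [Finset.sum_comm]

/-- `Jsum` is additive. [folklore] -/
theorem Jsum_add (i' : ℕ) (t₂ : Option ι → A) (F G : List (Option ι) → A) :
    Jsum i' t₂ (fun v => F v + G v) = Jsum i' t₂ F + Jsum i' t₂ G := by
  simp only [Jsum, add_mul, ← Finset.sum_add_distrib, ← pair_add_fun']

/-- `Jsum` is subtractive. [folklore] -/
theorem Jsum_sub (i' : ℕ) (t₂ : Option ι → A) (F G : List (Option ι) → A) :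
    Jsum i' t₂ (fun v => F v - G v) = Jsum i' t₂ F - Jsum i' t₂ G := by
  simp only [Jsum, sub_mul, ← Finset.sum_sub_distrib]
  refine Finset.sum_congr rfl fun g _ => ?_
  simp only [pair, Finsupp.sum, smul_sub, Finset.sum_sub_distrib]

/-- `Jsum` commutes with finite sums. [folklore] -/
theorem Jsum_finset_sum {κ : Type*} (s : Finset κ) (i' : ℕ) (t₂ : Option ι → A) (F : κ → List (Option ι) → A) :
    Jsum i' t₂ (fun v => ∑ x ∈ s, F x v) = ∑ x ∈ s, Jsum i' t₂ (F x) := by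
  simp only [Jsum, Finset.sum_mul, pair_finset_sum_fun]
  rw [Finset.sum_comm]

/-- A left constant passes through `Jsum`. [folklore] -/
theorem Jsum_mul_left (i' : ℕ) (t₂ : Option ι → A) (a : A) (F : List (Option ι) → A) :
    Jsum i' t₂ (fun v => a * F v) = a * Jsum i' t₂ F := by
  simp only [Jsum, mul_assoc, pair_mul_left, Finset.mul_sum]

/-- `Jsum` of the zero functional. [folklore] -/
theorem Jsum_zero (i' : ℕ) (t₂ : Option ι → A) : Jsum i' t₂ (fun _ => (0 : A)) = 0 := by
  simp [Jsum, pair, Finsupp.sum]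

/-- `Jsum'` is additive. [folklore] -/
theorem Jsum'_add (i : ℕ) (t₁ : Option ι → A) (F G : List (Option ι) → A) :
    Jsum' i t₁ (fun u => F u + G u) = Jsum' i t₁ F + Jsum' i t₁ G := by
  simp only [Jsum', mul_add, ← Finset.sum_add_distrib, ← pair_add_fun']

/-- `Jsum'` is subtractive. [folklore] -/
theorem Jsum'_sub (i : ℕ) (t₁ : Option ι → A) (F G : List (Option ι) → A) :
    Jsum' i t₁ (fun u => F u - G u) = Jsum' i t₁ F - Jsum' i t₁ G := by
  simp only [Jsum', mul_sub, ← Finset.sum_sub_distrib]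
  refine Finset.sum_congr rfl fun g _ => ?_
  simp only [pair, Finsupp.sum, smul_sub, Finset.sum_sub_distrib]

/-- `Jsum'` commutes with finite sums. [folklore] -/
theorem Jsum'_finset_sum {κ : Type*} (s : Finset κ) (i : ℕ) (t₁ : Option ι → A) (F : κ → List (Option ι) → A) :
    Jsum' i t₁ (fun u => ∑ x ∈ s, F x u) = ∑ x ∈ s, Jsum' i t₁ (F x) := by
  simp only [Jsum', Finset.mul_sum, pair_finset_sum_fun]
  rw [Finset.sum_comm]

/-- A right constant passes through `Jsum'`. [folklore] -/
theorem Jsum'_mul_right (i : ℕ) (t₁ : Option ι → A) (a : A) (F : List (Option ι) → A) :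
    Jsum' i t₁ (fun u => F u * a) = Jsum' i t₁ F * a := by
  simp only [Jsum', ← mul_assoc, pair_mul_right, Finset.sum_mul]

/-- `Jsum'` of the zero functional. [folklore] -/
theorem Jsum'_zero (i : ℕ) (t₁ : Option ι → A) : Jsum' i t₁ (fun _ => (0 : A)) = 0 := by
  simp [Jsum', pair, Finsupp.sum]

omit [Algebra ℚ R] [IsScalarTower ℚ R A] in
/-- `HH` is additive in the coefficient. [folklore] -/
theorem HH_add (i i' : ℕ) (t₁ t₂ : Option ι → A) (c c' : List (Option ι) → List (Option ι) → R) :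
    HH i i' t₁ t₂ (fun u v => c u v + c' u v) = HH i i' t₁ t₂ c + HH i i' t₁ t₂ c' := by
  simp only [HH, add_smul, ← Finset.sum_add_distrib, ← pair_add_fun']

omit [Algebra ℚ R] [IsScalarTower ℚ R A] in
/-- `HH` only depends on the coefficient values. [folklore] -/
theorem HH_congr {i i' : ℕ} {t₁ t₂ : Option ι → A} {c c' : List (Option ι) → List (Option ι) → R} (h : ∀ u v, c u v = c' u v) :
    HH i i' t₁ t₂ c = HH i i' t₁ t₂ c' := by
  simp only [HH, h]

omit [Algebra ℚ R] [IsScalarTower ℚ R A] in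
/-- `HH` of the zero coefficient. [folklore] -/
theorem HH_zero (i i' : ℕ) (t₁ t₂ : Option ι → A) : HH i i' t₁ t₂ (fun _ _ => (0 : R)) = 0 := by
  simp [HH, pair, Finsupp.sum]

/-- The word series of a two-word coefficient with the second word frozen. [folklore] -/
def serL (c : List (Option ι) → List (Option ι) → R) (v : List (Option ι)) : NCSeries (Option ι) R :=
  fun W => if W = [] then 0 else pair (fun u => c u v) (regEnd none W)

/-- The word series of a two-word coefficient with the first word frozen. [folklore] -/
def serR (c : List (Option ι) → List (Option ι) → R) (u : List (Option ι)) : NCSeries (Option ι) R :=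
  fun W => if W = [] then 0 else pair (fun v => c u v) (regEnd none W)

/-- **The honest double functional in the slot-1-active form.** [folklore] -/
theorem HH_eq_Jsum {i : ℕ} (hi : 0 < i) (i' : ℕ) (t₁ t₂ : Option ι → A) (c : List (Option ι) → List (Option ι) → R) :
    HH i i' t₁ t₂ c = Jsum i' t₂ fun v => evalW i t₁ (serL c v) := by
  have hne : ∀ f : Fin i → Option ι, List.ofFn f ≠ [] := by
    intro f h; have := congrArg List.length h; simp at this; omega
  unfold HH Jsum evalW
  rw [Finset.sum_comm]
  refine Finset.sum_congr rfl fun g _ => ?_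
  simp only [serL, if_neg (hne _), Finset.sum_mul, pair_finset_sum_fun, tprod]
  refine Finset.sum_congr rfl fun f _ => ?_
  simp only [pair, Finsupp.sum, Finset.sum_smul, Finset.smul_sum, Finset.sum_mul, smul_mul_assoc]
  rw [Finset.sum_comm]
  refine Finset.sum_congr rfl fun v _ => Finset.sum_congr rfl fun u _ => ?_
  rw [smul_assoc ((regEnd none (List.ofFn f)) u) (c u v), smul_smul, mul_comm, mul_smul]

/-- **The honest double functional in the slot-2-active form.** [folklore] -/
theorem HH_eq_Jsum' (i : ℕ) {i' : ℕ} (hi' : 0 < i') (t₁ t₂ : Option ι → A) (c : List (Option ι) → List (Option ι) → R) :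
    HH i i' t₁ t₂ c = Jsum' i t₁ fun u => evalW i' t₂ (serR c u) := by
  have hne : ∀ g : Fin i' → Option ι, List.ofFn g ≠ [] := by
    intro g h; have := congrArg List.length h; simp at this; omega
  unfold HH Jsum' evalW
  refine Finset.sum_congr rfl fun f _ => ?_
  simp only [serR, if_neg (hne _), tprod, Finset.mul_sum]
  rw [pair_finset_sum_fun]
  refine Finset.sum_congr rfl fun g _ => ?_
  simp only [pair, Finsupp.sum, Finset.sum_smul, Finset.mul_sum, mul_smul_comm, smul_assoc]

end JointSeries


/-! ## Derivative-free data; the joint functionals and their (S)-step -/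

section JointS

open Shuffle NCSeries

variable {R : Type} [CommRing R] [Algebra ℚ R] {χ : KZ.FormalRep →+ R} (hrel : ∀ c ∈ KZ.relations, χ c = 0)
variable {ι : Type} [Fintype ι] [DecidableEq ι] {m n₁ n₂ k M : ℕ}
variable {A : Type} [Ring A] [Algebra R A] [Module ℚ A] [IsScalarTower ℚ R A]

namespace DirData

/-- Direction data with vanishing transverse derivative data. [folklore] -/
def DerivFree (Δ : DirData ι M) : Prop := ∀ ℓ, Δ.N' ℓ = 0 ∧ Δ.M' ℓ = 0

omit [Fintype ι] [DecidableEq ι] in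
/-- Substitution preserves derivative-freeness. [folklore] -/
theorem DerivFree.substY {Δ₁ : DirData ι (m + 1)} (h : Δ₁.DerivFree) (Υ : MvPolynomial (Fin (m + k)) ℚ) (hΥ : IsScale Υ) :
    (Δ₁.substY Υ hΥ).DerivFree := fun ℓ => by
  constructor
  · show bind₁ (riderSubstY Υ) (Δ₁.N' ℓ) = 0
    rw [(h ℓ).1, map_zero]
  · show bind₁ (riderSubstY Υ) (Δ₁.M' ℓ) = 0
    rw [(h ℓ).2, map_zero]

omit [Fintype ι] [DecidableEq ι] in
/-- For derivative-free data the formal transverse derivative vanishes on the cube. [folklore] -/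
theorem fn_ZD_eq_zero {Δ : DirData ι M} (h : Δ.DerivFree) :
    ∀ (v : List (Option ι)) (z : Fin ((v.length + M) + 1) → ℝ), z ∈ KZ.cube ((v.length + M) + 1) → (Δ.ZD v).fn z = 0 := by
  have h0 : ∀ (a : Option ι) (w : Fin (M + 1) → ℝ), (Δ.headSD' a).fn w = 0 ∧ (Δ.lastSD' a).fn w = 0 := by
    intro a w
    cases a with
    | none => simp [headSD', lastSD', RFun.fn_const]
    | some ℓ =>
      simp only [headSD', lastSD', Option.elim]
      rw [fn_headSD, fn_lastSD]
      simp [N'r, M'r, (h ℓ).1, (h ℓ).2]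
  intro v
  induction v with
  | nil => intro z _; simp [ZD, RFun.fn_const]
  | cons a v ih =>
    intro z hz
    simp only [List.length_cons] at hz ⊢
    rw [fn_ZD_cons, peelFD]
    have hpz : peelPt z ∈ KZ.cube ((v.length + M) + 1) := peelPt_mem hz
    split_ifs with hv
    · rw [fn_liftS, (h0 a _).2]
    · rw [RFun.fn_add hpz, RFun.fn_mul, RFun.fn_mul, fn_liftS, (h0 a _).1, ih _ hpz]; ring

include hrel

omit [Algebra ℚ R] [Fintype ι] [DecidableEq ι] in
/-- For derivative-free data the `Y`-coefficients vanish. [folklore] -/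
theorem ycoef_eq_zero_of_derivFree {Δ : DirData ι M} (h : Δ.DerivFree) {k' : ℕ} (ρ : RFun (M + k')) (π : MvPolynomial (Fin (M + k')) ℚ)
    (hπ : IsScale π) (v : List (Option ι)) : Δ.ycoef (χ := χ) ρ π hπ v = 0 :=
  RFun.chi_eq_zero hrel fun y hy => by
    rw [fn_famTerm, Δ.fn_ZD_eq_zero h v _ (famPt_mem hπ hy), mul_zero]

omit [Module ℚ A] [IsScalarTower ℚ R A] in
/-- For derivative-free data the transverse series vanishes. [folklore] -/
theorem YS_eq_zero_of_derivFree {Δ : DirData ι M} (h : Δ.DerivFree) {k' : ℕ} (j : ℕ) (t : Option ι → A) (ρ : RFun (M + k'))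
    (π : MvPolynomial (Fin (M + k')) ℚ) (hπ : IsScale π) : Δ.YS (χ := χ) j t ρ π hπ = 0 := by
  unfold YS evalW
  refine Finset.sum_eq_zero fun f _ => ?_
  rw [Yser]
  split_ifs
  · rw [zero_smul]
  · rw [show pair (Δ.ycoef (χ := χ) ρ π hπ) (regEnd none (List.ofFn f)) = 0 from ?_, zero_smul]
    rw [← pair_zero' (K := R) (regEnd none (List.ofFn f))]
    exact pair_congr fun v _ => Δ.ycoef_eq_zero_of_derivFree hrel h ρ π hπ v

end DirData

/-! ### The joint functionals -/

/-- **Joint functional, slot 1 active** (degrees `i`, `i'`, middle insertion `mid`):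
`Σ_g ⟨ZS_i^{D₁}[absorb ρ Z^{D₂}_v] · mid · t₂^g, regEnd g⟩`. [folklore] -/
def JZ (D₁ D₂ : DirData ι M) (i i' : ℕ) (t₁ t₂ : Option ι → A) (mid : A) (ρ : RFun M) (π : MvPolynomial (Fin M) ℚ)
    (hπ : IsScale (m := M) (k := 0) π) : A :=
  Jsum i' t₂ fun v => ZS (χ := χ) (m := M) (k := v.length) D₁.c D₁.hc D₁.d D₁.hd i t₁ none
    (absorbR ρ (Zw D₂.c D₂.hc D₂.d D₂.hd v) π hπ) (liftPi v.length π) (isScale_liftPi hπ) * mid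

/-- Joint functional with `DS` in the active slot 1. [folklore] -/
def JD (D₁ D₂ : DirData ι M) (i i' : ℕ) (t₁ t₂ : Option ι → A) (mid : A) (ρ : RFun M) (π : MvPolynomial (Fin M) ℚ)
    (hπ : IsScale (m := M) (k := 0) π) : A :=
  Jsum i' t₂ fun v => DS (χ := χ) (m := M) (k := v.length) D₁.c D₁.hc D₁.d D₁.hd i t₁ none
    (absorbR ρ (Zw D₂.c D₂.hc D₂.d D₂.hd v) π hπ) (liftPi v.length π) (isScale_liftPi hπ) * mid

/-- Joint functional with `YS` in the active slot 1. [folklore] -/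
def JY (D₁ D₂ : DirData ι M) (i i' : ℕ) (t₁ t₂ : Option ι → A) (mid : A) (ρ : RFun M) (π : MvPolynomial (Fin M) ℚ)
    (hπ : IsScale (m := M) (k := 0) π) : A :=
  Jsum i' t₂ fun v => D₁.YS (χ := χ) (k := v.length) i t₁
    (absorbR ρ (Zw D₂.c D₂.hc D₂.d D₂.hd v) π hπ) (liftPi v.length π) (isScale_liftPi hπ) * mid

/-- **Joint functional, slot 2 active**: `Σ_f ⟨t₁^f · mid · ZS_{i'}^{D₂}[absorb ρ Z^{D₁}_u], regEnd f⟩`. [folklore] -/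
def JZ' (D₁ D₂ : DirData ι M) (i i' : ℕ) (t₁ t₂ : Option ι → A) (mid : A) (ρ : RFun M) (π : MvPolynomial (Fin M) ℚ)
    (hπ : IsScale (m := M) (k := 0) π) : A :=
  Jsum' i t₁ fun u => mid * ZS (χ := χ) (m := M) (k := u.length) D₂.c D₂.hc D₂.d D₂.hd i' t₂ none
    (absorbR ρ (Zw D₁.c D₁.hc D₁.d D₁.hd u) π hπ) (liftPi u.length π) (isScale_liftPi hπ)

/-- Joint functional with `DS` in the active slot 2. [folklore] -/
def JD' (D₁ D₂ : DirData ι M) (i i' : ℕ) (t₁ t₂ : Option ι → A) (mid : A) (ρ : RFun M) (π : MvPolynomial (Fin M) ℚ)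
    (hπ : IsScale (m := M) (k := 0) π) : A :=
  Jsum' i t₁ fun u => mid * DS (χ := χ) (m := M) (k := u.length) D₂.c D₂.hc D₂.d D₂.hd i' t₂ none
    (absorbR ρ (Zw D₁.c D₁.hc D₁.d D₁.hd u) π hπ) (liftPi u.length π) (isScale_liftPi hπ)

/-- The two-word coefficient of a joint: `⟪ρ · (Z^{D₁}_u ⊠ Z^{D₂}_v)[π]⟫`. [folklore] -/
def cbox (D₁ D₂ : DirData ι M) (ρ : RFun M) (π : MvPolynomial (Fin M) ℚ) (hπ : IsScale (m := M) (k := 0) π)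
    (u v : List (Option ι)) : R :=
  (famTerm (m := M) (k := 0) ρ (boxT (Zw D₁.c D₁.hc D₁.d D₁.hd u) (Zw D₂.c D₂.hc D₂.d D₂.hd v)) π hπ).chi χ

omit [IsScalarTower ℚ R A] in
/-- `Jsum` only depends on the values of the functional. [folklore] -/
theorem Jsum_congr {i' : ℕ} {t₂ : Option ι → A} {F G : List (Option ι) → A} (h : ∀ v, F v = G v) :
    Jsum i' t₂ F = Jsum i' t₂ G := by
  simp only [Jsum, h]

omit [IsScalarTower ℚ R A] in
/-- `Jsum'` only depends on the values of the functional. [folklore] -/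
theorem Jsum'_congr {i : ℕ} {t₁ : Option ι → A} {F G : List (Option ι) → A} (h : ∀ u, F u = G u) :
    Jsum' i t₁ F = Jsum' i t₁ G := by
  simp only [Jsum', h]

include hrel

/-- **The slot-1-active joint is the honest double functional** (`mid = 1`). [folklore] -/
theorem JZ_one_eq_HH (D₁ D₂ : DirData ι M) {i : ℕ} (hi : 0 < i) (i' : ℕ) (t₁ t₂ : Option ι → A) (ρ : RFun M)
    (π : MvPolynomial (Fin M) ℚ) (hπ : IsScale (m := M) (k := 0) π) :
    JZ (χ := χ) D₁ D₂ i i' t₁ t₂ 1 ρ π hπ = HH i i' t₁ t₂ (cbox (χ := χ) D₁ D₂ ρ π hπ) := by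
  rw [HH_eq_Jsum hi, JZ]
  refine Jsum_congr fun v => ?_
  rw [mul_one, ZS]
  congr 1
  funext W
  simp only [Zser, serL]
  split_ifs
  · rfl
  · exact pair_congr fun u _ => (chi_famTerm_boxT_absorb hrel ρ _ _ π hπ).symm

/-- **The slot-2-active joint is the honest double functional** (`mid = 1`). [folklore] -/
theorem JZ'_one_eq_HH (D₁ D₂ : DirData ι M) (i : ℕ) {i' : ℕ} (hi' : 0 < i') (t₁ t₂ : Option ι → A) (ρ : RFun M)
    (π : MvPolynomial (Fin M) ℚ) (hπ : IsScale (m := M) (k := 0) π) :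
    JZ' (χ := χ) D₁ D₂ i i' t₁ t₂ 1 ρ π hπ = HH i i' t₁ t₂ (cbox (χ := χ) D₁ D₂ ρ π hπ) := by
  rw [HH_eq_Jsum' i hi', JZ']
  refine Jsum'_congr fun u => ?_
  rw [one_mul, ZS]
  congr 1
  funext W
  simp only [Zser, serR]
  split_ifs
  · rfl
  · exact pair_congr fun v _ => by
      rw [zcoef, ← chi_famTerm_boxT_absorb hrel ρ _ _ π hπ, cbox, chi_famTerm_boxT_swap hrel]

/-- **Slot change**: the two absorbed forms of the joint agree (`mid = 1`, both degrees positive). [folklore] -/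
theorem JZ_one_eq_JZ' (D₁ D₂ : DirData ι M) {i i' : ℕ} (hi : 0 < i) (hi' : 0 < i') (t₁ t₂ : Option ι → A) (ρ : RFun M)
    (π : MvPolynomial (Fin M) ℚ) (hπ : IsScale (m := M) (k := 0) π) :
    JZ (χ := χ) D₁ D₂ i i' t₁ t₂ 1 ρ π hπ = JZ' (χ := χ) D₁ D₂ i i' t₁ t₂ 1 ρ π hπ := by
  rw [JZ_one_eq_HH hrel D₁ D₂ hi, JZ'_one_eq_HH hrel D₁ D₂ i hi']

/-! ### The (S)-step of a `τ`-weighted joint -/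

omit [Algebra ℚ R] [Fintype ι] [DecidableEq ι] in
/-- **Reading a `τ`-weighted joint of tied blocks through the family**: if the tied blocks agree with
`V₁, V₂` on the cube then `⟪ρ · (τ W₁⊠W₂)[Y:=π][π]⟫ = ⟪(ρπ) · (V₁ ⊠ V₂)[π]⟫`. [folklore] -/
theorem chi_famTerm_famY_X_boxT {k' : ℕ} (ρ : RFun (m + k')) (W₁ : RFun ((n₁ + (m + 1)) + 1)) (W₂ : RFun ((n₂ + (m + 1)) + 1))
    (V₁ : RFun ((n₁ + (m + k')) + 1)) (V₂ : RFun ((n₂ + (m + k')) + 1)) (π : MvPolynomial (Fin (m + k')) ℚ) (hπ : IsScale π)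
    (h₁ : ∀ z ∈ KZ.cube ((n₁ + (m + k')) + 1), (famY W₁ π hπ).fn z = V₁.fn z)
    (h₂ : ∀ z ∈ KZ.cube ((n₂ + (m + k')) + 1), (famY W₂ π hπ).fn z = V₂.fn z) :
    (famTerm (m := m + k') (k := 0) ρ (famY ((RFun.poly (X (Fin.last _))).mul (boxT W₁ W₂)) π hπ) π hπ).chi χ =
      (famTerm (m := m + k') (k := 0) (ρ.mul (RFun.poly π)) (boxT V₁ V₂) π hπ).chi χ := by
  refine RFun.chi_congr hrel fun y hy => ?_
  have hz := famPt_mem (n := n₁ + n₂) (m := m + k') (k := 0) hπ hy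
  rw [fn_famTerm, fn_famTerm, fn_famY_X_boxT, RFun.fn_mul, RFun.fn_poly, aeval_X, fn_boxT, fn_boxT,
    h₁ _ (projB_mem hz).1, h₂ _ (projB_mem hz).2, RFun.fn_mul, RFun.fn_poly]
  rw [show famPt (n₁ + n₂) (m := m + k') (k := 0) π y (Fin.last _) = wScale (famPt (n₁ + n₂) (m := m + k') (k := 0) π y) from rfl,
    wScale_famPt]
  ring

omit hrel [Algebra ℚ R] [Fintype ι] [DecidableEq ι] in
/-- The `∂_τ(τ·)`-bridge for tied word functions of substituted data. [folklore] -/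
theorem fn_famY_scaleDeriv_Zw_substY {k' : ℕ} (Δ₁ : DirData ι (m + 1)) (Υ : MvPolynomial (Fin (m + k')) ℚ) (hΥ : IsScale Υ)
    (w : List (Option ι)) {z : Fin ((w.length + (m + k')) + 1) → ℝ} (hz : z ∈ KZ.cube ((w.length + (m + k')) + 1)) :
    (famY (scaleDeriv (Zw Δ₁.c Δ₁.hc Δ₁.d Δ₁.hd w)) Υ hΥ).fn z =
      (scaleDeriv (Zw (Δ₁.substY Υ hΥ).c (Δ₁.substY Υ hΥ).hc (Δ₁.substY Υ hΥ).d (Δ₁.substY Υ hΥ).hd w)).fn z := by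
  rw [fn_famY_scaleDeriv _ _ hΥ hz]
  exact fn_scaleDeriv_congr (fun z' hz' => fn_famY_Zw_substY Δ₁ Υ hΥ w hz') hz

/-- Absorbed two-word `D`-coefficient: `dcoef^{Da}(absorb ρ Z^{Dp}_v)(u)`. [folklore] -/
def cD (Da Dp : DirData ι M) (ρ : RFun M) (π : MvPolynomial (Fin M) ℚ) (hπ : IsScale (m := M) (k := 0) π)
    (u v : List (Option ι)) : R :=
  dcoef (χ := χ) (m := M) (k := v.length) Da.c Da.hc Da.d Da.hd (absorbR ρ (Zw Dp.c Dp.hc Dp.d Dp.hd v) π hπ)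
    (liftPi v.length π) (isScale_liftPi hπ) u

/-- Absorbed two-word `Y`-coefficient: `ycoef^{Da}(absorb ρ Z^{Dp}_v)(u)`. [folklore] -/
def cY (Da Dp : DirData ι M) (ρ : RFun M) (π : MvPolynomial (Fin M) ℚ) (hπ : IsScale (m := M) (k := 0) π)
    (u v : List (Option ι)) : R :=
  Da.ycoef (χ := χ) (k := v.length) (absorbR ρ (Zw Dp.c Dp.hc Dp.d Dp.hd v) π hπ) (liftPi v.length π) (isScale_liftPi hπ) u

/-- Absorbed two-word `Z`-coefficient: `zcoef^{Da}(absorb ρ Z^{Dp}_v)(u)`. [folklore] -/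
def cZ (Da Dp : DirData ι M) (ρ : RFun M) (π : MvPolynomial (Fin M) ℚ) (hπ : IsScale (m := M) (k := 0) π)
    (u v : List (Option ι)) : R :=
  zcoef (χ := χ) (m := M) (k := v.length) Da.c Da.hc Da.d Da.hd (absorbR ρ (Zw Dp.c Dp.hc Dp.d Dp.hd v) π hπ)
    (liftPi v.length π) (isScale_liftPi hπ) u

omit [Algebra ℚ R] [Fintype ι] [DecidableEq ι] in
/-- The absorbed `Z`-coefficient is the joint coefficient. [folklore] -/
theorem cZ_eq_cbox (D₁ D₂ : DirData ι M) (ρ : RFun M) (π : MvPolynomial (Fin M) ℚ) (hπ : IsScale (m := M) (k := 0) π)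
    (u v : List (Option ι)) : cZ (χ := χ) D₁ D₂ ρ π hπ u v = cbox (χ := χ) D₁ D₂ ρ π hπ u v :=
  (chi_famTerm_boxT_absorb hrel ρ _ _ π hπ).symm

omit [Algebra ℚ R] [Fintype ι] [DecidableEq ι] in
/-- The absorbed `Z`-coefficient of the swapped pair is the joint coefficient. [folklore] -/
theorem cZ_swap_eq_cbox (D₁ D₂ : DirData ι M) (ρ : RFun M) (π : MvPolynomial (Fin M) ℚ) (hπ : IsScale (m := M) (k := 0) π)
    (u v : List (Option ι)) : cZ (χ := χ) D₂ D₁ ρ π hπ v u = cbox (χ := χ) D₁ D₂ ρ π hπ u v := by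
  rw [cZ, zcoef, ← chi_famTerm_boxT_absorb hrel ρ _ _ π hπ, cbox, chi_famTerm_boxT_swap hrel]

omit [Algebra ℚ R] [Fintype ι] [DecidableEq ι] in
/-- **The (S)-step of the joint, two-word coefficient by coefficient.** For `Y`-dependent data
`Δ₁, Δ₂` (`Δ₂` derivative-free) read at `Y := π`:
`cbox_{Δ∘π}(ρπ; π)(u,v) = cD⁺(u,v) + cY⁺(u,v) + cD⁺_{swapped}(v,u)` at `(ρ⁺π⁺; π⁺)`. [folklore] -/
theorem cbox_substY_diag_S (Δ₁ Δ₂ : DirData ι (m + 1)) (hD₁ : Δ₁.IsDeriv) (hD₂ : Δ₂.IsDeriv) (hF₂ : Δ₂.DerivFree)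
    (ρ : RFun (m + k)) (π : MvPolynomial (Fin (m + k)) ℚ) (hπ : IsScale π) (u v : List (Option ι)) :
    cbox (χ := χ) (M := m + k) (Δ₁.substY π hπ) (Δ₂.substY π hπ) (ρ.mul (RFun.poly π)) π hπ u v =
      cD (χ := χ) (M := m + (k + 1)) (Δ₁.substY (k := k + 1) (scaleMul π) (isScale_scaleMul hπ))
          (Δ₂.substY (k := k + 1) (scaleMul π) (isScale_scaleMul hπ)) (ρ.lift.mul (RFun.poly (scaleMul π))) (scaleMul π)
          (isScale_scaleMul hπ) u v +
      cY (χ := χ) (M := m + (k + 1)) (Δ₁.substY (k := k + 1) (scaleMul π) (isScale_scaleMul hπ))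
          (Δ₂.substY (k := k + 1) (scaleMul π) (isScale_scaleMul hπ)) (ρ.lift.mul (RFun.poly (scaleMul π))) (scaleMul π)
          (isScale_scaleMul hπ) u v +
      cD (χ := χ) (M := m + (k + 1)) (Δ₂.substY (k := k + 1) (scaleMul π) (isScale_scaleMul hπ))
          (Δ₁.substY (k := k + 1) (scaleMul π) (isScale_scaleMul hπ)) (ρ.lift.mul (RFun.poly (scaleMul π))) (scaleMul π)
          (isScale_scaleMul hπ) v u := by
  have hπ' := isScale_scaleMul hπ
  set Δ₁' := Δ₁.substY (k := k + 1) (scaleMul π) hπ' with hΔ₁'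
  set Δ₂' := Δ₂.substY (k := k + 1) (scaleMul π) hπ' with hΔ₂'
  -- Step 1: untie at `π`
  have h1 : cbox (χ := χ) (M := m + k) (Δ₁.substY π hπ) (Δ₂.substY π hπ) (ρ.mul (RFun.poly π)) π hπ u v =
      (famTerm (m := m + k) (k := 0) ρ (famY ((RFun.poly (X (Fin.last _))).mul
        (boxT (Zw Δ₁.c Δ₁.hc Δ₁.d Δ₁.hd u) (Zw Δ₂.c Δ₂.hc Δ₂.d Δ₂.hd v))) π hπ) π hπ).chi χ :=
    (chi_famTerm_famY_X_boxT hrel (m := m) (k' := k) ρ _ _ _ _ π hπ (fun z hz => fn_famY_Zw_substY Δ₁ π hπ u hz)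
      (fun z hz => fn_famY_Zw_substY Δ₂ π hπ v hz)).symm
  rw [h1, chi_famTerm_X_boxT_diag hrel ρ _ _ π hπ]
  -- Step 2: re-tie the four pieces at `π⁺`
  have e1 := chi_famTerm_famY_X_boxT hrel (m := m) (k' := k + 1) (n₁ := u.length) (n₂ := v.length) ρ.lift
    (scaleDeriv (Zw Δ₁.c Δ₁.hc Δ₁.d Δ₁.hd u)) (Zw Δ₂.c Δ₂.hc Δ₂.d Δ₂.hd v)
    (scaleDeriv (Zw Δ₁'.c Δ₁'.hc Δ₁'.d Δ₁'.hd u)) (Zw Δ₂'.c Δ₂'.hc Δ₂'.d Δ₂'.hd v) (scaleMul π) hπ'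
    (fun z hz => fn_famY_scaleDeriv_Zw_substY Δ₁ (scaleMul π) hπ' u hz) (fun z hz => fn_famY_Zw_substY Δ₂ (scaleMul π) hπ' v hz)
  have e2 := chi_famTerm_famY_X_boxT hrel (m := m) (k' := k + 1) (n₁ := u.length) (n₂ := v.length) ρ.lift
    (smulY (pdY (Zw Δ₁.c Δ₁.hc Δ₁.d Δ₁.hd u))) (Zw Δ₂.c Δ₂.hc Δ₂.d Δ₂.hd v)
    (Δ₁'.ZD u) (Zw Δ₂'.c Δ₂'.hc Δ₂'.d Δ₂'.hd v) (scaleMul π) hπ'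
    (fun z hz => Δ₁.fn_famY_YZw (scaleMul π) hπ' hD₁ u z hz) (fun z hz => fn_famY_Zw_substY Δ₂ (scaleMul π) hπ' v hz)
  have e3 := chi_famTerm_famY_X_boxT hrel (m := m) (k' := k + 1) (n₁ := u.length) (n₂ := v.length) ρ.lift
    (Zw Δ₁.c Δ₁.hc Δ₁.d Δ₁.hd u) (scaleDeriv (Zw Δ₂.c Δ₂.hc Δ₂.d Δ₂.hd v))
    (Zw Δ₁'.c Δ₁'.hc Δ₁'.d Δ₁'.hd u) (scaleDeriv (Zw Δ₂'.c Δ₂'.hc Δ₂'.d Δ₂'.hd v)) (scaleMul π) hπ'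
    (fun z hz => fn_famY_Zw_substY Δ₁ (scaleMul π) hπ' u hz) (fun z hz => fn_famY_scaleDeriv_Zw_substY Δ₂ (scaleMul π) hπ' v hz)
  have e4 : (famTerm (m := m + (k + 1)) (k := 0) ρ.lift (famY (k := k + 1) ((RFun.poly (X (Fin.last _))).mul
      (boxT (Zw Δ₁.c Δ₁.hc Δ₁.d Δ₁.hd u) (smulY (pdY (Zw Δ₂.c Δ₂.hc Δ₂.d Δ₂.hd v))))) (scaleMul π) hπ') (scaleMul π) hπ').chi χ = 0 := by
    rw [chi_famTerm_famY_X_boxT hrel (m := m) (k' := k + 1) (n₁ := u.length) (n₂ := v.length) ρ.lift _ _ (Zw Δ₁'.c Δ₁'.hc Δ₁'.d Δ₁'.hd u) (Δ₂'.ZD v)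
      (scaleMul π) hπ' (fun z hz => fn_famY_Zw_substY Δ₁ (scaleMul π) hπ' u hz) (fun z hz => Δ₂.fn_famY_YZw (scaleMul π) hπ' hD₂ v z hz)]
    refine RFun.chi_eq_zero hrel fun y hy => ?_
    rw [fn_famTerm, fn_boxT, Δ₂'.fn_ZD_eq_zero (hF₂.substY _ _) v _ (projB_mem (famPt_mem (m := m + (k + 1)) (k := 0) hπ' hy)).2,
      mul_zero, mul_zero]
  rw [e1, e2, e3, e4, add_zero]
  -- Step 3: absorb (slot 1) / swap and absorb (slot 2)
  rw [chi_famTerm_boxT_absorb hrel, chi_famTerm_boxT_absorb hrel, chi_famTerm_boxT_swap hrel, chi_famTerm_boxT_absorb hrel]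
  rfl

/-! ### The (S)-step at the level of the joint functionals -/

omit hrel in
/-- `HH` of the absorbed `D`-coefficient is `JD` (`mid = 1`). [folklore] -/
theorem HH_cD (D₁ D₂ : DirData ι M) {i : ℕ} (hi : 0 < i) (i' : ℕ) (t₁ t₂ : Option ι → A) (ρ : RFun M)
    (π : MvPolynomial (Fin M) ℚ) (hπ : IsScale (m := M) (k := 0) π) :
    HH i i' t₁ t₂ (cD (χ := χ) D₁ D₂ ρ π hπ) = JD (χ := χ) D₁ D₂ i i' t₁ t₂ 1 ρ π hπ := by
  rw [HH_eq_Jsum hi, JD]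
  refine Jsum_congr fun v => ?_
  rw [mul_one, DS]
  rfl

omit hrel in
/-- `HH` of the absorbed `Y`-coefficient is `JY` (`mid = 1`). [folklore] -/
theorem HH_cY (D₁ D₂ : DirData ι M) {i : ℕ} (hi : 0 < i) (i' : ℕ) (t₁ t₂ : Option ι → A) (ρ : RFun M)
    (π : MvPolynomial (Fin M) ℚ) (hπ : IsScale (m := M) (k := 0) π) :
    HH i i' t₁ t₂ (cY (χ := χ) D₁ D₂ ρ π hπ) = JY (χ := χ) D₁ D₂ i i' t₁ t₂ 1 ρ π hπ := by
  rw [HH_eq_Jsum hi, JY]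
  refine Jsum_congr fun v => ?_
  rw [mul_one, DirData.YS]
  rfl

omit hrel in
/-- `HH` of the swapped absorbed `D`-coefficient is `JD'` (`mid = 1`). [folklore] -/
theorem HH_cD_swap (D₁ D₂ : DirData ι M) (i : ℕ) {i' : ℕ} (hi' : 0 < i') (t₁ t₂ : Option ι → A) (ρ : RFun M)
    (π : MvPolynomial (Fin M) ℚ) (hπ : IsScale (m := M) (k := 0) π) :
    HH i i' t₁ t₂ (fun u v => cD (χ := χ) D₂ D₁ ρ π hπ v u) = JD' (χ := χ) D₁ D₂ i i' t₁ t₂ 1 ρ π hπ := by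
  rw [HH_eq_Jsum' i hi', JD']
  refine Jsum'_congr fun u => ?_
  rw [one_mul, DS]
  rfl

/-- **The (S)-step of the `τ`-weighted joint functional**:
`JZ^{Δ₁∘π,Δ₂∘π}_{i,i'}[ρπ](π) = JD⁺ + JY⁺ + JD'⁺` at `[ρ⁺π⁺](π⁺)` (both degrees positive, `Δ₂`
derivative-free). [folklore] -/
theorem JZ_substY_diag_S (Δ₁ Δ₂ : DirData ι (m + 1)) (hD₁ : Δ₁.IsDeriv) (hD₂ : Δ₂.IsDeriv) (hF₂ : Δ₂.DerivFree)
    {i i' : ℕ} (hi : 0 < i) (hi' : 0 < i') (t₁ t₂ : Option ι → A) (ρ : RFun (m + k)) (π : MvPolynomial (Fin (m + k)) ℚ)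
    (hπ : IsScale π) :
    JZ (χ := χ) (M := m + k) (Δ₁.substY π hπ) (Δ₂.substY π hπ) i i' t₁ t₂ 1 (ρ.mul (RFun.poly π)) π hπ =
      JD (χ := χ) (M := m + (k + 1)) (Δ₁.substY (k := k + 1) (scaleMul π) (isScale_scaleMul hπ))
          (Δ₂.substY (k := k + 1) (scaleMul π) (isScale_scaleMul hπ)) i i' t₁ t₂ 1 (ρ.lift.mul (RFun.poly (scaleMul π)))
          (scaleMul π) (isScale_scaleMul hπ) +
      JY (χ := χ) (M := m + (k + 1)) (Δ₁.substY (k := k + 1) (scaleMul π) (isScale_scaleMul hπ))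
          (Δ₂.substY (k := k + 1) (scaleMul π) (isScale_scaleMul hπ)) i i' t₁ t₂ 1 (ρ.lift.mul (RFun.poly (scaleMul π)))
          (scaleMul π) (isScale_scaleMul hπ) +
      JD' (χ := χ) (M := m + (k + 1)) (Δ₁.substY (k := k + 1) (scaleMul π) (isScale_scaleMul hπ))
          (Δ₂.substY (k := k + 1) (scaleMul π) (isScale_scaleMul hπ)) i i' t₁ t₂ 1 (ρ.lift.mul (RFun.poly (scaleMul π)))
          (scaleMul π) (isScale_scaleMul hπ) := by
  rw [JZ_one_eq_HH hrel _ _ hi, ← HH_cD _ _ hi, ← HH_cY _ _ hi, ← HH_cD_swap _ _ i hi', ← HH_add, ← HH_add]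
  exact HH_congr fun u v => cbox_substY_diag_S hrel Δ₁ Δ₂ hD₁ hD₂ hF₂ ρ π hπ u v

end JointS


/-! ## Axis commutation: a residue commuting with the connection commutes with the regularised series -/

section AxisComm

open Shuffle NCSeries

variable {R : Type} [CommRing R] [Algebra ℚ R] {χ : KZ.FormalRep →+ R} (hrel : ∀ c ∈ KZ.relations, χ c = 0)
variable {ι : Type} [Fintype ι] [DecidableEq ι] {m : ℕ}
variable {A : Type} [Ring A] [Algebra R A] [Module ℚ A] [IsScalarTower ℚ R A]

namespace DirData

variable (Δ : DirData ι m) (R)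

/-- **Axis commutation hypothesis** for an element `X`: `X` commutes with the axis residue and with
the connection value `Ω(w)` at every rational point of the open box. [folklore] -/
def AxisComm (t : Option ι → A) (X : A) : Prop :=
  Commute X (t none) ∧ ∀ w : Fin (m + 1) → ℚ, (∀ i, 0 < w i ∧ w i < 1) → Commute X (Δ.Om R t w)

variable {R}

omit [DecidableEq ι] [Module ℚ A] [IsScalarTower ℚ R A] in
/-- The pointwise content of axis commutation: `Σ_ℓ c_ℓ(w) [X, t_ℓ] = 0`. [folklore] -/
theorem AxisComm.sum_cq {t : Option ι → A} {X : A} (h : Δ.AxisComm R t X) (w : Fin (m + 1) → ℚ)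
    (hw : ∀ i, 0 < w i ∧ w i < 1) : ∑ ℓ, algebraMap ℚ R (Δ.cq ℓ w) • (X * t (some ℓ) - t (some ℓ) * X) = 0 := by
  have h1 := sub_eq_zero.2 (h.2 w hw)
  have h0 : X * t none - t none * X = 0 := sub_eq_zero.2 h.1
  rw [Om, mul_add, add_mul, Finset.mul_sum, Finset.sum_mul] at h1
  have : X * t none + ∑ ℓ, X * (algebraMap ℚ R (Δ.cq ℓ w) • t (some ℓ)) -
      (t none * X + ∑ ℓ, algebraMap ℚ R (Δ.cq ℓ w) • t (some ℓ) * X) =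
      (X * t none - t none * X) + ∑ ℓ, algebraMap ℚ R (Δ.cq ℓ w) • (X * t (some ℓ) - t (some ℓ) * X) := by
    simp only [smul_sub, Finset.sum_sub_distrib, mul_smul_comm, smul_mul_assoc]; abel
  rw [this, h0, zero_add] at h1
  exact h1

include hrel

/-- **Axis commutation passes to the regularised series**: if `X` commutes with the axis residue and
with `Ω` pointwise, then `X · ZS_p[ρ] = ZS_p[ρ] · X` for every multiplier. [folklore] -/
theorem comm_ZS_of_axisComm (hc0 : 0 < Δ.c) {t : Option ι → A} {X : A} (hX : Δ.AxisComm R t X) :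
    ∀ (p k : ℕ) (ρ : RFun (m + k)) (π : MvPolynomial (Fin (m + k)) ℚ) (hπ : IsScale π),
      X * ZS (χ := χ) Δ.c Δ.hc Δ.d Δ.hd p t none ρ π hπ = ZS (χ := χ) Δ.c Δ.hc Δ.d Δ.hd p t none ρ π hπ * X := by
  intro p
  induction p with
  | zero => intro k ρ π hπ; simp
  | succ p ih =>
    intro k ρ π hπ
    have hπ' := isScale_scaleMul hπ
    rw [ZS_eq_DS hrel, DS_succ hrel Δ.c Δ.hc Δ.d Δ.hd none Δ.d_none p t ρ.lift (scaleMul π) hπ']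
    -- the pieces commute with `X`
    have hG : ∀ (G : A), (X * G = G * X) → X * (G * t none) = G * t none * X := by
      intro G hG; rw [← mul_assoc, hG, mul_assoc, hX.1.eq, ← mul_assoc]
    have hsc : ∀ r : R, X * (r • (1 : A)) = r • (1 : A) * X := by intro r; rw [mul_smul_comm, smul_mul_assoc, mul_one, one_mul]
    have hHcomm : ∀ a, X * (if p = 0 then (ρ.lift.mul (lastMult (m := m) (k := k + 1) Δ.c Δ.hc (Δ.d a) (Δ.hd a) (scaleMul π) hπ')).chi χ • (1 : A)
        else ZS (χ := χ) (m := m) (k := k + 1) Δ.c Δ.hc Δ.d Δ.hd p t none (ρ.lift.mul (headMult (m := m) (k := k + 1) Δ.c Δ.hc (Δ.d a) (Δ.hd a) (scaleMul π) hπ')) (scaleMul π) hπ') =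
        (if p = 0 then (ρ.lift.mul (lastMult (m := m) (k := k + 1) Δ.c Δ.hc (Δ.d a) (Δ.hd a) (scaleMul π) hπ')).chi χ • (1 : A)
        else ZS (χ := χ) (m := m) (k := k + 1) Δ.c Δ.hc Δ.d Δ.hd p t none (ρ.lift.mul (headMult (m := m) (k := k + 1) Δ.c Δ.hc (Δ.d a) (Δ.hd a) (scaleMul π) hπ')) (scaleMul π) hπ') * X := by
      intro a; split_ifs
      · exact hsc _
      · exact ih (k + 1) _ _ hπ'
    have hGcomm : X * (if p = 0 then ρ.lift.chi χ • (1 : A) else ZS (χ := χ) (m := m) (k := k + 1) Δ.c Δ.hc Δ.d Δ.hd p t none ρ.lift (scaleMul π) hπ') =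
        (if p = 0 then ρ.lift.chi χ • (1 : A) else ZS (χ := χ) (m := m) (k := k + 1) Δ.c Δ.hc Δ.d Δ.hd p t none ρ.lift (scaleMul π) hπ') * X := by
      split_ifs
      · exact hsc _
      · exact ih (k + 1) _ _ hπ'
    -- the killed commutator sum
    have hkill : ∑ a, (X * t a - t a * X) * (if p = 0 then (ρ.lift.mul (lastMult (m := m) (k := k + 1) Δ.c Δ.hc (Δ.d a) (Δ.hd a) (scaleMul π) hπ')).chi χ • (1 : A)
        else ZS (χ := χ) (m := m) (k := k + 1) Δ.c Δ.hc Δ.d Δ.hd p t none (ρ.lift.mul (headMult (m := m) (k := k + 1) Δ.c Δ.hc (Δ.d a) (Δ.hd a) (scaleMul π) hπ')) (scaleMul π) hπ') = 0 := by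
      rw [Fintype.sum_option, sub_eq_zero.2 hX.1, zero_mul, zero_add]
      split_ifs with hp
      · -- boundary: kill with the last factors
        have hpt : ∀ x : Fin (m + 1) → ℚ, (∀ i, 0 < x i ∧ x i < 1) →
            ∑ ℓ, algebraMap ℚ R ((lastS Δ.c Δ.hc (Δ.d (some ℓ)) (Δ.hd (some ℓ))).evalQ x) • (X * t (some ℓ) - t (some ℓ) * X) = 0 := by
          intro x hx
          have hu : Δ.uq x ≠ 0 := mul_ne_zero hc0.ne' (hx _).1.ne'
          have h1 := hX.sum_cq Δ x hx
          simp only [cq_eq_uq_mul_lq, map_mul, mul_smul, ← Finset.smul_sum] at h1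
          simp only [evalQ_lastS_some]
          have := congrArg (fun b => algebraMap ℚ R (Δ.uq x)⁻¹ • b) h1
          simpa only [smul_smul, ← map_mul, inv_mul_cancel₀ hu, map_one, one_smul, smul_zero] using this
        have hk := chi_famTerm_kill hrel (A := A) (m := m) (k := k + 1) (n := 0) (fun (q : ℚ) (b : A) => algebraMap_smul R q b)
          (fun ℓ => lastS Δ.c Δ.hc (Δ.d (some ℓ)) (Δ.hd (some ℓ))) (fun ℓ => X * t (some ℓ) - t (some ℓ) * X) hpt
          ρ.lift (RFun.const 1) (scaleMul π) hπ'
        simp only [chi_famTerm_const_one hrel] at hk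
        rw [← hk]
        refine Finset.sum_congr rfl fun ℓ _ => ?_
        rw [mul_smul_comm, mul_one, lastMult]
      · -- interior: kill inside the series
        refine sum_mul_ZS_eq_zero (χ := χ) (m := m) (k := k + 1) Δ.c Δ.hc Δ.d Δ.hd
          (fun ℓ => ρ.lift.mul (headMult (m := m) (k := k + 1) Δ.c Δ.hc (Δ.d (some ℓ)) (Δ.hd (some ℓ)) (scaleMul π) hπ'))
          (fun ℓ => X * t (some ℓ) - t (some ℓ) * X) (scaleMul π) hπ' (fun v => ?_) p t none
        have hk := chi_famTerm_kill hrel (A := A) (m := m) (k := k + 1) (fun (q : ℚ) (b : A) => algebraMap_smul R q b)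
          (fun ℓ => headS Δ.c Δ.hc (Δ.d (some ℓ)) (Δ.hd (some ℓ))) (fun ℓ => X * t (some ℓ) - t (some ℓ) * X)
          (fun x hx => by simp only [evalQ_headS_some]; exact hX.sum_cq Δ x hx) ρ.lift (Zw Δ.c Δ.hc Δ.d Δ.hd v) (scaleMul π) hπ'
        rw [← hk]
        rfl
    -- assemble
    rw [mul_sub, sub_mul, Finset.mul_sum, Finset.sum_mul, hG _ hGcomm]
    congr 1
    have hterm : ∀ a, X * (t a * (if p = 0 then (ρ.lift.mul (lastMult (m := m) (k := k + 1) Δ.c Δ.hc (Δ.d a) (Δ.hd a) (scaleMul π) hπ')).chi χ • (1 : A)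
        else ZS (χ := χ) (m := m) (k := k + 1) Δ.c Δ.hc Δ.d Δ.hd p t none (ρ.lift.mul (headMult (m := m) (k := k + 1) Δ.c Δ.hc (Δ.d a) (Δ.hd a) (scaleMul π) hπ')) (scaleMul π) hπ')) =
        (X * t a - t a * X) * (if p = 0 then (ρ.lift.mul (lastMult (m := m) (k := k + 1) Δ.c Δ.hc (Δ.d a) (Δ.hd a) (scaleMul π) hπ')).chi χ • (1 : A)
        else ZS (χ := χ) (m := m) (k := k + 1) Δ.c Δ.hc Δ.d Δ.hd p t none (ρ.lift.mul (headMult (m := m) (k := k + 1) Δ.c Δ.hc (Δ.d a) (Δ.hd a) (scaleMul π) hπ')) (scaleMul π) hπ') +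
        t a * (if p = 0 then (ρ.lift.mul (lastMult (m := m) (k := k + 1) Δ.c Δ.hc (Δ.d a) (Δ.hd a) (scaleMul π) hπ')).chi χ • (1 : A)
        else ZS (χ := χ) (m := m) (k := k + 1) Δ.c Δ.hc Δ.d Δ.hd p t none (ρ.lift.mul (headMult (m := m) (k := k + 1) Δ.c Δ.hc (Δ.d a) (Δ.hd a) (scaleMul π) hπ')) (scaleMul π) hπ') * X := by
      intro a
      rw [mul_assoc, ← hHcomm a, sub_mul, ← mul_assoc, ← mul_assoc, sub_add_cancel]
    simp only [hterm, Finset.sum_add_distrib, hkill, zero_add]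

end DirData

end AxisComm


/-! ## Dummy riders: the transport equation at residues for any number of riders -/

section Dummy

open Shuffle NCSeries

variable {R : Type} [CommRing R] [Algebra ℚ R] {χ : KZ.FormalRep →+ R} (hrel : ∀ c ∈ KZ.relations, χ c = 0)
variable {ι : Type} [Fintype ι] [DecidableEq ι] {m n k : ℕ}
variable {A : Type} [Ring A] [Algebra R A]
variable (c : ℚ) (hc : 0 ≤ c) (d : ι → Letter m) (hd : ∀ a, (d a).IsRegular c)

include hrel

omit [Algebra ℚ R] [Fintype ι] [DecidableEq ι] in
/-- Integrating out one dummy variable. [folklore] -/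
theorem RFun.chi_lift' {M : ℕ} (T : RFun M) : T.lift.chi χ = T.chi χ := by
  rw [← RFun.chi_liftN hrel T 1]
  exact RFun.chi_congr hrel fun y _ => by rw [RFun.fn_lift, RFun.fn_liftN]; rfl

omit [Algebra ℚ R] [Fintype ι] [DecidableEq ι] in
/-- **A dummy rider does not change the family class**: with the multiplier lifted and the scale
renamed, `⟪ρ⁺ · T[π↑]⟫ = ⟪ρ · T[π]⟫`. [folklore] -/
theorem chi_famTerm_dummy (ρ : RFun (m + k)) (T : RFun ((n + m) + 1)) (π : MvPolynomial (Fin (m + k)) ℚ) (hπ : IsScale π) :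
    (famTerm (m := m) (k := k + 1) ρ.lift T (liftPi 1 π) (isScale_liftPi (M := m + k) (n₂ := 1) hπ)).chi χ = (famTerm ρ T π hπ).chi χ := by
  rw [← RFun.chi_lift' hrel (famTerm ρ T π hπ)]
  refine RFun.chi_congr hrel fun y _ => ?_
  rw [RFun.fn_lift, fn_famTerm, fn_famTerm, RFun.fn_lift]
  have hr : Fin.init (fun i : Fin (m + (k + 1)) => y (Fin.natAdd n i)) = fun i : Fin (m + k) => Fin.init y (Fin.natAdd n i) := by
    funext i; rfl
  have hsc : aeval (fun i : Fin (m + (k + 1)) => y (Fin.natAdd n i)) (liftPi 1 π) = aeval (fun i : Fin (m + k) => Fin.init y (Fin.natAdd n i)) π := by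
    rw [liftPi, MvPolynomial.aeval_rename]; rfl
  rw [hr]
  congr 1
  congr 1
  apply layout_ext
  · funext j; rw [wX_famPt, wX_famPt]; rfl
  · funext j; rw [wRider_famPt, wRider_famPt]; rfl
  · rw [wScale_famPt, wScale_famPt, hsc]

omit [Algebra ℚ R] [Fintype ι] [DecidableEq ι] in
/-- A dummy rider does not change a multiplier class with a scale-reading factor. [folklore] -/
theorem chi_mul_scaleFam_dummy (ρ : RFun (m + k)) (g : RFun (m + 1)) (π : MvPolynomial (Fin (m + k)) ℚ) (hπ : IsScale π) :
    (ρ.lift.mul (scaleFam (m := m) (k := k + 1) g (liftPi 1 π) (isScale_liftPi (M := m + k) (n₂ := 1) hπ))).chi χ =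
      (ρ.mul (scaleFam g π hπ)).chi χ := by
  rw [← RFun.chi_lift' hrel (ρ.mul (scaleFam g π hπ))]
  refine RFun.chi_congr hrel fun y _ => ?_
  rw [RFun.fn_lift, RFun.fn_mul, RFun.fn_mul, RFun.fn_lift, fn_scaleFam, fn_scaleFam, liftPi, MvPolynomial.aeval_rename]
  rfl

omit hrel [Algebra ℚ R] [Fintype ι] [DecidableEq ι] in
/-- The lifted product with a scale-reading factor, pointwise. [folklore] -/
theorem fn_lift_mul_scaleFam_dummy (ρ : RFun (m + k)) (g : RFun (m + 1)) (π : MvPolynomial (Fin (m + k)) ℚ) (hπ : IsScale π)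
    (e : Fin (m + (k + 1)) → ℝ) :
    (ρ.lift.mul (scaleFam (m := m) (k := k + 1) g (liftPi 1 π) (isScale_liftPi (M := m + k) (n₂ := 1) hπ))).fn e =
      ((ρ.mul (scaleFam g π hπ)).lift).fn e := by
  rw [RFun.fn_lift, RFun.fn_mul, RFun.fn_mul, RFun.fn_lift, fn_scaleFam, fn_scaleFam, liftPi, MvPolynomial.aeval_rename]
  rfl

omit [DecidableEq ι] in
/-- A dummy rider does not change `ZS`. [folklore] -/
theorem ZS_dummy [DecidableEq ι] (j : ℕ) (t : ι → A) (o : ι) (ρ : RFun (m + k)) (π : MvPolynomial (Fin (m + k)) ℚ) (hπ : IsScale π) :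
    ZS (χ := χ) (m := m) (k := k + 1) c hc d hd j t o ρ.lift (liftPi 1 π) (isScale_liftPi (M := m + k) (n₂ := 1) hπ) =
      ZS (χ := χ) c hc d hd j t o ρ π hπ := by
  unfold ZS; congr 1; funext W
  simp only [Zser]
  split_ifs
  · rfl
  · exact pair_congr fun v _ => chi_famTerm_dummy hrel ρ _ π hπ

omit [DecidableEq ι] in
/-- A dummy rider does not change `DS`. [folklore] -/
theorem DS_dummy [DecidableEq ι] (j : ℕ) (t : ι → A) (o : ι) (ρ : RFun (m + k)) (π : MvPolynomial (Fin (m + k)) ℚ) (hπ : IsScale π) :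
    DS (χ := χ) (m := m) (k := k + 1) c hc d hd j t o ρ.lift (liftPi 1 π) (isScale_liftPi (M := m + k) (n₂ := 1) hπ) =
      DS (χ := χ) c hc d hd j t o ρ π hπ := by
  unfold DS; congr 1; funext W
  simp only [Dser]
  split_ifs
  · rfl
  · exact pair_congr fun v _ => chi_famTerm_dummy hrel ρ _ π hπ

/-- **(O) at residues for any number of riders**:
`DS_{j+1}(ρ,π) = Σ_ℓ t_ℓ · ([j=0]⟪ρ last_ℓ⟫ + ZS_j(ρ c_ℓ, π)) − ([j=0]⟪ρ⟫ + ZS_j(ρ,π)) · t_o`. [cite: IharaKanekoZagier2006, §3] -/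
theorem DS_succ' (o : ι) (hdo : d o = Letter.inv) (j : ℕ) (t : ι → A) (ρ : RFun (m + k))
    (π : MvPolynomial (Fin (m + k)) ℚ) (hπ : IsScale π) :
    DS (χ := χ) c hc d hd (j + 1) t o ρ π hπ =
      ∑ ℓ : ι, t ℓ * (if j = 0 then (ρ.mul (lastMult c hc (d ℓ) (hd ℓ) π hπ)).chi χ • (1 : A)
          else ZS (χ := χ) c hc d hd j t o (ρ.mul (headMult c hc (d ℓ) (hd ℓ) π hπ)) π hπ) -
        (if j = 0 then ρ.chi χ • (1 : A) else ZS (χ := χ) c hc d hd j t o ρ π hπ) * t o := by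
  have hπ1 : IsScale (m := m) (k := k + 1) (liftPi 1 π) := isScale_liftPi (M := m + k) (n₂ := 1) hπ
  rw [← DS_dummy hrel c hc d hd (j + 1) t o ρ π hπ]
  rw [DS_succ hrel c hc d hd o hdo j t ρ.lift (liftPi 1 π) hπ1]
  by_cases hj : j = 0
  · subst hj
    simp only [↓reduceIte]
    refine congrArg₂ (· - ·) (Finset.sum_congr rfl fun ℓ _ => ?_) ?_
    · rw [lastMult, lastMult, chi_mul_scaleFam_dummy hrel]
    · rw [RFun.chi_lift' hrel]
  · simp only [if_neg hj]
    refine congrArg₂ (· - ·) (Finset.sum_congr rfl fun ℓ _ => ?_) ?_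
    · rw [headMult, headMult, ZS_congr_mult hrel (m := m) (k := k + 1) c hc d hd (fun e _ => fn_lift_mul_scaleFam_dummy ρ _ π hπ e),
        ZS_dummy hrel]
    · rw [ZS_dummy hrel]

end Dummy


/-! ## Expansions of the joint functionals in the active slot -/

section JointExpand

open Shuffle NCSeries

variable {R : Type} [CommRing R] [Algebra ℚ R] {χ : KZ.FormalRep →+ R} (hrel : ∀ c ∈ KZ.relations, χ c = 0)
variable {ι : Type} [Fintype ι] [DecidableEq ι] {M n₂ : ℕ}
variable {A : Type} [Ring A] [Algebra R A] [Module ℚ A] [IsScalarTower ℚ R A]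

/-- The block swap `(x₂, e) ↦ (e, x₂)` reading an absorbed multiplier as a family. [folklore] -/
def absEquiv (M n₂ : ℕ) : Fin (n₂ + M) ≃ Fin (M + n₂) :=
  finSumFinEquiv.symm.trans ((Equiv.sumComm (Fin n₂) (Fin M)).trans finSumFinEquiv)

omit [Fintype ι] [DecidableEq ι] in
/-- The block swap on word coordinates. [folklore] -/
@[simp] theorem absEquiv_castAdd (M n₂ : ℕ) (j : Fin n₂) : absEquiv M n₂ (Fin.castAdd M j) = Fin.natAdd M j := by
  simp [absEquiv]

omit [Fintype ι] [DecidableEq ι] in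
/-- The block swap on rider coordinates. [folklore] -/
@[simp] theorem absEquiv_natAdd (M n₂ : ℕ) (i : Fin M) : absEquiv M n₂ (Fin.natAdd n₂ i) = Fin.castAdd n₂ i := by
  simp [absEquiv]

include hrel

omit [Algebra ℚ R] [Fintype ι] [DecidableEq ι] in
/-- **The class of an absorbed multiplier is the passive word coefficient**:
`⟪absorb ρ T₂⟫ = ⟪ρ · T₂[π]⟫`. [folklore] -/
theorem chi_absorbR (ρ : RFun M) (T₂ : RFun ((n₂ + M) + 1)) (π : MvPolynomial (Fin M) ℚ) (hπ : IsScale (m := M) (k := 0) π) :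
    (absorbR ρ T₂ π hπ).chi χ = (famTerm (m := M) (k := 0) ρ T₂ π hπ).chi χ := by
  set G : RFun (n₂ + M) := famTerm (m := M) (k := 0) ρ T₂ π hπ with hG
  rw [← RFun.chi_rename hrel G (absEquiv M n₂)]
  refine RFun.chi_congr hrel fun w _ => ?_
  rw [RFun.fn_rename, hG, fn_famTerm, fn_absorbR]
  have hr : (fun i : Fin (M + 0) => (w ∘ absEquiv M n₂) (Fin.natAdd n₂ i)) = fun i : Fin M => w (Fin.castAdd n₂ i) := by
    funext i; simp only [Function.comp_apply]; exact congrArg w (absEquiv_natAdd M n₂ i)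
  rw [hr]
  congr 1
  congr 1
  apply layout_ext
  · funext j; rw [wX_famPt]; simp only [absPt, wX, Fin.snoc_castSucc, Fin.append_left, Function.comp_apply]
    exact congrArg w (absEquiv_castAdd M n₂ j).symm
  · funext j; rw [wRider_famPt]
    simp only [absPt, wRider, Fin.snoc_castSucc, Fin.append_right, Function.comp_apply]
    exact congrArg w (absEquiv_natAdd M n₂ j).symm
  · rw [wScale_famPt, hr]; simp only [absPt, wScale, Fin.snoc_last]

omit [Algebra ℚ R] [Fintype ι] [DecidableEq ι] in
/-- Un-absorbing a scale-reading factor in a multiplier class. [folklore] -/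
theorem chi_absorbR_mul_scaleFam (ρ : RFun M) (T₂ : RFun ((n₂ + M) + 1)) (π : MvPolynomial (Fin M) ℚ)
    (hπ : IsScale (m := M) (k := 0) π) (g : RFun (M + 1)) :
    ((absorbR ρ T₂ π hπ).mul (scaleFam (m := M) (k := n₂) g (liftPi n₂ π) (isScale_liftPi hπ))).chi χ =
      (famTerm (m := M) (k := 0) (ρ.mul (scaleFam (m := M) (k := 0) g π hπ)) T₂ π hπ).chi χ := by
  rw [← chi_absorbR hrel]
  exact RFun.chi_congr hrel fun w _ => fn_absorbR_mul_scaleFam ρ T₂ π hπ g w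

omit hrel [Fintype ι] [DecidableEq ι] in
/-- `pair` against a scalar-valued functional times a fixed element. [folklore] -/
theorem pair_smul_const (c : List (Option ι) → R) (x : A) (F : List (Option ι) →₀ ℚ) :
    pair (fun v => c v • x) F = pair c F • x := by
  simp only [pair, Finsupp.sum, Finset.sum_smul, smul_assoc]

omit hrel in
/-- **Boundary sums collapse to a single**: `Σ_g ⟨zcoef₂(v) • (mid · t₂^g), regEnd g⟩ = mid · ZS₂`
(positive degree). [folklore] -/
theorem Jsum_zcoef_smul (D₂ : DirData ι M) {i' : ℕ} (hi' : 0 < i') (t₂ : Option ι → A) (mid : A) (ρ' : RFun M)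
    (π : MvPolynomial (Fin M) ℚ) (hπ : IsScale (m := M) (k := 0) π) :
    Jsum i' t₂ (fun v => zcoef (χ := χ) (m := M) (k := 0) D₂.c D₂.hc D₂.d D₂.hd ρ' π hπ v • mid) =
      mid * ZS (χ := χ) (m := M) (k := 0) D₂.c D₂.hc D₂.d D₂.hd i' t₂ none ρ' π hπ := by
  have hne : ∀ g : Fin i' → Option ι, List.ofFn g ≠ [] := by
    intro g h; have := congrArg List.length h; simp at this; omega
  unfold Jsum ZS evalW
  rw [Finset.mul_sum]
  refine Finset.sum_congr rfl fun g _ => ?_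
  simp only [Zser, if_neg (hne g), tprod, smul_mul_assoc, mul_smul_comm]
  exact pair_smul_const _ _ _

omit hrel [Algebra ℚ R] [Fintype ι] [DecidableEq ι] [Module ℚ A] [IsScalarTower ℚ R A] in
/-- A scalar class times `1`, multiplied: `(r • 1) * x = r • x`. [folklore] -/
theorem smul_one_mul' (r : R) (x : A) : (r • (1 : A)) * x = r • x := by rw [smul_mul_assoc, one_mul]

/-- **Expansion of `JD` in the active slot** (`(O)` at residues inside the joint):
`JD_{i+1,i'}[ρ] = Σ_a t_a · ([i=0] mid·ZS₂[ρ last_a] | JZ_{i,i'}[ρ c_a]) − ([i=0] t_o·mid·ZS₂[ρ] | JZ^{t_o mid}_{i,i'}[ρ])`.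
[folklore] -/
theorem JD_succ (D₁ D₂ : DirData ι M) (i : ℕ) {i' : ℕ} (hi' : 0 < i') (t₁ t₂ : Option ι → A) (mid : A) (ρ : RFun M)
    (π : MvPolynomial (Fin M) ℚ) (hπ : IsScale (m := M) (k := 0) π) :
    JD (χ := χ) D₁ D₂ (i + 1) i' t₁ t₂ mid ρ π hπ =
      ∑ a, t₁ a * (if i = 0 then mid * ZS (χ := χ) (m := M) (k := 0) D₂.c D₂.hc D₂.d D₂.hd i' t₂ none
            (ρ.mul (lastMult (m := M) (k := 0) D₁.c D₁.hc (D₁.d a) (D₁.hd a) π hπ)) π hπ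
          else JZ (χ := χ) D₁ D₂ i i' t₁ t₂ mid (ρ.mul (headMult (m := M) (k := 0) D₁.c D₁.hc (D₁.d a) (D₁.hd a) π hπ)) π hπ) -
      (if i = 0 then t₁ none * mid * ZS (χ := χ) (m := M) (k := 0) D₂.c D₂.hc D₂.d D₂.hd i' t₂ none ρ π hπ
        else JZ (χ := χ) D₁ D₂ i i' t₁ t₂ (t₁ none * mid) ρ π hπ) := by
  unfold JD
  -- expand `DS` in every passive word
  have hexp : ∀ v : List (Option ι),
      DS (χ := χ) (m := M) (k := v.length) D₁.c D₁.hc D₁.d D₁.hd (i + 1) t₁ none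
        (absorbR ρ (Zw D₂.c D₂.hc D₂.d D₂.hd v) π hπ) (liftPi v.length π) (isScale_liftPi hπ) * mid =
      ∑ a, t₁ a * ((if i = 0 then zcoef (χ := χ) (m := M) (k := 0) D₂.c D₂.hc D₂.d D₂.hd
            (ρ.mul (lastMult (m := M) (k := 0) D₁.c D₁.hc (D₁.d a) (D₁.hd a) π hπ)) π hπ v • mid
          else ZS (χ := χ) (m := M) (k := v.length) D₁.c D₁.hc D₁.d D₁.hd i t₁ none
            (absorbR (ρ.mul (headMult (m := M) (k := 0) D₁.c D₁.hc (D₁.d a) (D₁.hd a) π hπ)) (Zw D₂.c D₂.hc D₂.d D₂.hd v) π hπ)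
            (liftPi v.length π) (isScale_liftPi hπ) * mid)) -
      (if i = 0 then zcoef (χ := χ) (m := M) (k := 0) D₂.c D₂.hc D₂.d D₂.hd ρ π hπ v • (t₁ none * mid)
        else ZS (χ := χ) (m := M) (k := v.length) D₁.c D₁.hc D₁.d D₁.hd i t₁ none
            (absorbR ρ (Zw D₂.c D₂.hc D₂.d D₂.hd v) π hπ) (liftPi v.length π) (isScale_liftPi hπ) * (t₁ none * mid)) := by
    intro v
    rw [DS_succ' hrel (m := M) (k := v.length) D₁.c D₁.hc D₁.d D₁.hd none D₁.d_none i t₁ _ _ (isScale_liftPi hπ), sub_mul,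
      Finset.sum_mul]
    refine congrArg₂ (· - ·) (Finset.sum_congr rfl fun a _ => ?_) ?_
    · rw [mul_assoc]
      refine congrArg (t₁ a * ·) ?_
      split_ifs
      · rw [smul_one_mul', lastMult, chi_absorbR_mul_scaleFam hrel, zcoef, lastMult]
      · rw [headMult, ZS_congr_mult hrel (m := M) (k := v.length) D₁.c D₁.hc D₁.d D₁.hd
          (fun w _ => fn_absorbR_mul_scaleFam ρ _ π hπ _ w), headMult]
    · split_ifs
      · rw [mul_assoc, smul_one_mul', chi_absorbR hrel, zcoef]
      · rw [mul_assoc]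
  rw [Jsum_congr hexp, Jsum_sub, Jsum_finset_sum]
  refine congrArg₂ (· - ·) (Finset.sum_congr rfl fun a _ => ?_) ?_
  · rw [Jsum_mul_left]
    refine congrArg (t₁ a * ·) ?_
    split_ifs
    · exact Jsum_zcoef_smul D₂ hi' t₂ mid _ π hπ
    · rfl
  · split_ifs
    · rw [Jsum_zcoef_smul D₂ hi' t₂ _ ρ π hπ]
    · rfl

/-- **Expansion of `JY` in the active slot** (TF-Z inside the joint). [folklore] -/
theorem JY_tfz (D₁ D₂ : DirData ι M) (hc0 : 0 < D₁.c) {t₁ : Option ι → A} {tT₁ : A} (hF : D₁.Flat R t₁ tT₁)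
    (i : ℕ) {i' : ℕ} (hi' : 0 < i') (t₂ : Option ι → A) (mid : A) (ρ : RFun M)
    (π : MvPolynomial (Fin M) ℚ) (hπ : IsScale (m := M) (k := 0) π) :
    JY (χ := χ) D₁ D₂ (i + 1) i' t₁ t₂ mid ρ π hπ =
      tT₁ * JZ (χ := χ) D₁ D₂ i i' t₁ t₂ mid ρ π hπ - JZ (χ := χ) D₁ D₂ i i' t₁ t₂ (tT₁ * mid) ρ π hπ +
      ∑ ℓ, (t₁ (some ℓ) * JZ (χ := χ) D₁ D₂ i i' t₁ t₂ mid (ρ.mul (scaleFam (m := M) (k := 0) (D₁.eS ℓ) π hπ)) π hπ -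
        JZ (χ := χ) D₁ D₂ i i' t₁ t₂ (t₁ (some ℓ) * mid) (ρ.mul (scaleFam (m := M) (k := 0) (D₁.e0S ℓ) π hπ)) π hπ) +
      (if i = 0 then ∑ ℓ, t₁ (some ℓ) * mid * ZS (χ := χ) (m := M) (k := 0) D₂.c D₂.hc D₂.d D₂.hd i' t₂ none
        (ρ.mul (scaleFam (m := M) (k := 0) (D₁.ebrS ℓ) π hπ)) π hπ else 0) := by
  unfold JY JZ
  have hexp : ∀ v : List (Option ι),
      D₁.YS (χ := χ) (k := v.length) (i + 1) t₁ (absorbR ρ (Zw D₂.c D₂.hc D₂.d D₂.hd v) π hπ) (liftPi v.length π)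
        (isScale_liftPi hπ) * mid =
      tT₁ * (ZS (χ := χ) (m := M) (k := v.length) D₁.c D₁.hc D₁.d D₁.hd i t₁ none (absorbR ρ (Zw D₂.c D₂.hc D₂.d D₂.hd v) π hπ)
          (liftPi v.length π) (isScale_liftPi hπ) * mid) -
        ZS (χ := χ) (m := M) (k := v.length) D₁.c D₁.hc D₁.d D₁.hd i t₁ none (absorbR ρ (Zw D₂.c D₂.hc D₂.d D₂.hd v) π hπ)
          (liftPi v.length π) (isScale_liftPi hπ) * (tT₁ * mid) +
      ∑ ℓ, (t₁ (some ℓ) * (ZS (χ := χ) (m := M) (k := v.length) D₁.c D₁.hc D₁.d D₁.hd i t₁ none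
          (absorbR (ρ.mul (scaleFam (m := M) (k := 0) (D₁.eS ℓ) π hπ)) (Zw D₂.c D₂.hc D₂.d D₂.hd v) π hπ)
          (liftPi v.length π) (isScale_liftPi hπ) * mid) -
        ZS (χ := χ) (m := M) (k := v.length) D₁.c D₁.hc D₁.d D₁.hd i t₁ none
          (absorbR (ρ.mul (scaleFam (m := M) (k := 0) (D₁.e0S ℓ) π hπ)) (Zw D₂.c D₂.hc D₂.d D₂.hd v) π hπ)
          (liftPi v.length π) (isScale_liftPi hπ) * (t₁ (some ℓ) * mid)) +
      (if i = 0 then ∑ ℓ, zcoef (χ := χ) (m := M) (k := 0) D₂.c D₂.hc D₂.d D₂.hd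
          (ρ.mul (scaleFam (m := M) (k := 0) (D₁.ebrS ℓ) π hπ)) π hπ v • (t₁ (some ℓ) * mid) else 0) := by
    intro v
    rw [D₁.tfz hrel t₁ tT₁ hc0 hF i v.length _ _ (isScale_liftPi hπ), add_mul, add_mul, sub_mul, Finset.sum_mul]
    refine congrArg₂ (· + ·) (congrArg₂ (· + ·) ?_ (Finset.sum_congr rfl fun ℓ _ => ?_)) ?_
    · rw [mul_assoc, mul_assoc]
    · rw [sub_mul, mul_assoc, mul_assoc,
        ZS_congr_mult hrel (m := M) (k := v.length) D₁.c D₁.hc D₁.d D₁.hd (fun w _ => fn_absorbR_mul_scaleFam ρ _ π hπ _ w),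
        ZS_congr_mult hrel (m := M) (k := v.length) D₁.c D₁.hc D₁.d D₁.hd (ρ₁ := (absorbR ρ _ π hπ).mul _)
          (fun w _ => fn_absorbR_mul_scaleFam ρ _ π hπ _ w)]
    · split_ifs
      · rw [Finset.sum_mul]
        refine Finset.sum_congr rfl fun ℓ _ => ?_
        rw [smul_mul_assoc, chi_absorbR_mul_scaleFam hrel, zcoef]
      · rw [zero_mul]
  rw [Jsum_congr hexp, Jsum_add, Jsum_add, Jsum_sub, Jsum_finset_sum, Jsum_mul_left]
  refine congrArg₂ (· + ·) (congrArg₂ (· + ·) rfl (Finset.sum_congr rfl fun ℓ _ => ?_)) ?_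
  · rw [Jsum_sub, Jsum_mul_left]
  · split_ifs
    · rw [Jsum_finset_sum]
      refine Finset.sum_congr rfl fun ℓ _ => ?_
      rw [Jsum_zcoef_smul D₂ hi' t₂ _ _ π hπ, mul_assoc]
    · exact Jsum_zero _ _

omit [IsScalarTower ℚ R A] in
/-- **Expansion of `JD'` in the active slot 2**:
`JD'_{i,i'+1}[ρ] = Σ_a ([i'=0] ZS₁[ρ last_a]·mid·t_a | JZ'^{mid t_a}_{i,i'}[ρ c_a]) − ([i'=0] ZS₁[ρ]·mid | JZ'_{i,i'}[ρ]) · t_o`.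
[folklore] -/
theorem JD'_succ (D₁ D₂ : DirData ι M) {i : ℕ} (hi : 0 < i) (i' : ℕ) (t₁ t₂ : Option ι → A) (mid : A) (ρ : RFun M)
    (π : MvPolynomial (Fin M) ℚ) (hπ : IsScale (m := M) (k := 0) π) :
    JD' (χ := χ) D₁ D₂ i (i' + 1) t₁ t₂ mid ρ π hπ =
      ∑ a, (if i' = 0 then ZS (χ := χ) (m := M) (k := 0) D₁.c D₁.hc D₁.d D₁.hd i t₁ none
            (ρ.mul (lastMult (m := M) (k := 0) D₂.c D₂.hc (D₂.d a) (D₂.hd a) π hπ)) π hπ * (mid * t₂ a)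
          else JZ' (χ := χ) D₁ D₂ i i' t₁ t₂ (mid * t₂ a) (ρ.mul (headMult (m := M) (k := 0) D₂.c D₂.hc (D₂.d a) (D₂.hd a) π hπ)) π hπ) -
      (if i' = 0 then ZS (χ := χ) (m := M) (k := 0) D₁.c D₁.hc D₁.d D₁.hd i t₁ none ρ π hπ * mid
        else JZ' (χ := χ) D₁ D₂ i i' t₁ t₂ mid ρ π hπ) * t₂ none := by
  unfold JD' JZ'
  have hexp : ∀ u : List (Option ι),
      mid * DS (χ := χ) (m := M) (k := u.length) D₂.c D₂.hc D₂.d D₂.hd (i' + 1) t₂ none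
        (absorbR ρ (Zw D₁.c D₁.hc D₁.d D₁.hd u) π hπ) (liftPi u.length π) (isScale_liftPi hπ) =
      ∑ a, (if i' = 0 then zcoef (χ := χ) (m := M) (k := 0) D₁.c D₁.hc D₁.d D₁.hd
            (ρ.mul (lastMult (m := M) (k := 0) D₂.c D₂.hc (D₂.d a) (D₂.hd a) π hπ)) π hπ u • (mid * t₂ a)
          else (mid * t₂ a) * ZS (χ := χ) (m := M) (k := u.length) D₂.c D₂.hc D₂.d D₂.hd i' t₂ none
            (absorbR (ρ.mul (headMult (m := M) (k := 0) D₂.c D₂.hc (D₂.d a) (D₂.hd a) π hπ)) (Zw D₁.c D₁.hc D₁.d D₁.hd u) π hπ)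
            (liftPi u.length π) (isScale_liftPi hπ)) -
      (if i' = 0 then zcoef (χ := χ) (m := M) (k := 0) D₁.c D₁.hc D₁.d D₁.hd ρ π hπ u • mid
        else mid * ZS (χ := χ) (m := M) (k := u.length) D₂.c D₂.hc D₂.d D₂.hd i' t₂ none
            (absorbR ρ (Zw D₁.c D₁.hc D₁.d D₁.hd u) π hπ) (liftPi u.length π) (isScale_liftPi hπ)) * t₂ none := by
    intro u
    rw [DS_succ' hrel (m := M) (k := u.length) D₂.c D₂.hc D₂.d D₂.hd none D₂.d_none i' t₂ _ _ (isScale_liftPi hπ), mul_sub,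
      Finset.mul_sum, ← mul_assoc]
    refine congrArg₂ (· - ·) (Finset.sum_congr rfl fun a _ => ?_) (congrArg (· * t₂ none) ?_)
    · split_ifs
      · rw [mul_smul_comm, mul_one, mul_smul_comm, lastMult, chi_absorbR_mul_scaleFam hrel, zcoef, lastMult]
      · rw [← mul_assoc, headMult, ZS_congr_mult hrel (m := M) (k := u.length) D₂.c D₂.hc D₂.d D₂.hd
          (fun w _ => fn_absorbR_mul_scaleFam ρ _ π hπ _ w), headMult]
    · split_ifs
      · rw [mul_smul_comm, mul_one, chi_absorbR hrel, zcoef]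
      · rfl
  rw [Jsum'_congr hexp, Jsum'_sub, Jsum'_finset_sum, Jsum'_mul_right]
  refine congrArg₂ (· - ·) (Finset.sum_congr rfl fun a _ => ?_) (congrArg (· * t₂ none) ?_)
  · split_ifs
    · exact Jsum'_zcoef_smul D₁ hi t₁ _ _ π hπ
    · rfl
  · split_ifs
    · exact Jsum'_zcoef_smul D₁ hi t₁ _ ρ π hπ
    · rfl
where
  /-- Boundary sums in the mirror form collapse to a single: `Σ_f ⟨t₁^f · (zcoef₁(u) • x), regEnd f⟩ = ZS₁ · x`. -/
  Jsum'_zcoef_smul (D₁ : DirData ι M) {i : ℕ} (hi : 0 < i) (t₁ : Option ι → A) (x : A) (ρ' : RFun M)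
      (π : MvPolynomial (Fin M) ℚ) (hπ : IsScale (m := M) (k := 0) π) :
      Jsum' i t₁ (fun u => zcoef (χ := χ) (m := M) (k := 0) D₁.c D₁.hc D₁.d D₁.hd ρ' π hπ u • x) =
        ZS (χ := χ) (m := M) (k := 0) D₁.c D₁.hc D₁.d D₁.hd i t₁ none ρ' π hπ * x := by
    have hne : ∀ f : Fin i → Option ι, List.ofFn f ≠ [] := by
      intro f h; have := congrArg List.length h; simp at this; omega
    unfold Jsum' ZS evalW
    rw [Finset.sum_mul]
    refine Finset.sum_congr rfl fun f _ => ?_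
    simp only [Zser, if_neg (hne f), tprod, mul_smul_comm, smul_mul_assoc]
    exact pair_smul_const _ _ _

end JointExpand

end Literature.NumberTheory.Transcendental.KZ.Cube
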